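import Mathlib
import HarnessLib
import HarnessLib.Audit
import Summits.Langlands.Statement
import Summits.Langlands.Langlands.Theses.TameDarkSplit
import Summits.Langlands.Langlands.Theorems.TameDarkSplitCMLayerPatching

/-!
# CoherentChamberNode — decomp-langlands lens-3 («one certified translation + split beneath»), generation 13

TREE TWIN (census-1 g17, lens RUNME/OFFER L908 (M)): this file = `HOME/nodes/lens-3-g13-CoherentChamberSplit.lean` (sha256 48941972ff19…, 327 lines)
with the namespace moved to `Summit.Langlands.Langlands.Theorems.TameDarkSplitCoherentChamber`, the eight trailing `#print axioms` lines dropped and eleven one-line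
docstrings added (doc lint); the S ⟹ SDT certificate `wildDark_of_langlands` is imported from `Theorems/TameDarkSplitCMLayerPatching.lean`
(already landed, gate dedup) instead of restated; statements byte-identical to the node and to the child-route kit items (DEG / LV / LI / DSC / W⁺ / FRAME).


TARGET  SDT = `TameDarkSplit.WildDarkAutomorphy` (stmt-Langlands-33249; crux r4, layer 1 of route-Langlands-TameDarkSplit):
weak automorphy (∃ cuspidal L-algebraic π, Satake = Frobenius a.e.) of the WILD DARK irreducible geometric ℓ-adic ρ of G_K,
K totally real: no wide regularising move (no solvable-sandwich avatar that is HT-regular / of holomorphic limit type of rank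
≤ 4 / of finite image) and no tame move.  Existing cuts of SDT: in-route VDK ∨ IDK (𝕋(K)-visibility, g11) and the OR-sibling
child route CMLayerSplit (quadratic-twist primitivity + STRONG automorphy over CM quadratic layers, g12).  This node is a THIRD
OR-sibling child route, `--refines TameDarkSplit:WildDarkAutomorphy`.

WHY THE CUT IS MADE AT SDT AND NOT AT CMV 27419 (CMLayerSplit's declared residual).  CMV concludes STRONG automorphy of ρ|_E
(full `Corresponds 𝓡E`: local–global compatibility at every finite place incl. ℓ = p at SINGULAR weight), which the g12 descent
needed for its multi-layer patching.  Every sub-cell of CMV inherits that conclusion, and no engine in any language produces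
ℓ = p compatibility at irregular weight.  The translation below has teeth only with WEAK conclusions, i.e. as a cut of SDT; its
descent is single-layer and sign-free (given W⁺), so neither PRIM nor strong `Corresponds` is needed.

THE DIAL (K-side, on ρ itself; ⊗χ-invariant and stable under restriction to solvable layers).  LIM(ρ) := the three hypotheses
of the host's HL_TR `HolomorphicLimitAutomorphy` 32003 with the rank cap `n ≤ 4` REMOVED:
  (B)  ρ carries a TOTALLY-ODD-SIGNED POLARISATION: a nondegenerate B with ᵗB = ±B, ρ(g) acting by similitudes of B, and
       B·ρ(c) symmetric for every complex conjugation c of K (the Bellaïche–Chenevier sign at every real place);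
  (M)  every labelled Hodge–Tate weight of ρ has MULTIPLICITY ≤ 2 (at every v ∣ ℓ, every embedding τ);
  (¬R) ρ is not HT-regular.
Inside the wild dark box LIM forces rank ≥ 5 (a LIM member of rank ≤ 4 is its own W(ii) avatar with M = E₀ = K, θ = ρ, χ = 1).
DICTIONARY (why (B) ∧ (M) is the right line).  For a polarised ρ the Hodge–Tate multiset at a real place is the infinitesimal
character of the conjectural archimedean parameter on the unitary group U(n)_{E/K} (any CM quadratic E/K) resp. GSp/GO; (M) says
that character is singular only along SHORT walls (A₁ × … × A₁), which is exactly the condition that it be the infinitesimal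
character of a NON-DEGENERATE LIMIT OF DISCRETE SERIES for some inner form U(a_v, b_v) (Knapp–Zuckerman; Vogan–Zuckerman), and
non-degenerate limits of discrete series are precisely the archimedean components realised in the COHERENT cohomology of the
(toroidally compactified) Shimura variety — Harris 1990 §3 («Automorphic forms of ∂̄-cohomology type as coherent cohomology
classes», J. Diff. Geom. 32), made unconditional in all degrees by Su 2018 (arXiv:1810.12056, main theorem: H^i(Sh^tor_Σ, V^can)
= H^i_{(𝔭_h, K_h)}(𝒜(G) ⊗ V)).  Multiplicity ≥ 3 at some place = singular along a long wall in EVERY chamber = Gross's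
incompleteness phenomenon (abelian g-folds g ≥ 3, K3 surfaces of Picard rank ≤ 16; Gross 2016 / Goldring–Koskivirta 2019 §1):
such ρ are seen by no Shimura cohomology of any kind.  So the dial separates «coherent-visible on a unitary/Siegel Shimura variety
after base change» (LIM) from «Shimura-invisible» (DEG), uniformly in the rank.

THE TRANSLATION (the one EQUIV of lens 3).  For ρ in the box with LIM(ρ):
    LIMK(ρ): ρ weakly automorphic over K   ⟺   LIMU(ρ): ρ|_E weakly automorphic over EVERY CM quadratic layer E ∋ √-d on which
                                                ρ|_E is irreducible and pinned-geometric (w.r.t. every reciprocity datum of E)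
modulo two named inputs, both Langlands-implied and both in print: (BC) Arthur–Clozel weak quadratic base change — BC_{E/K}(π) is
cuspidal because ρ|_E is irreducible (AC 1989 Ch. 3 Thm 4.2 / 5.1; node-only `WeakQuadraticBaseChange`) and (DSC) SINGLE-LAYER
SIGN-FREE DESCENT given W⁺ (support item `LimitLayerDescent`: pick E = K(√-p) with ρ|_E irreducible — all but ≤ n² quadratic
η satisfy ρ ⊗ η ≄ ρ; if Π_E is cuspidal with Satake = Frob(ρ|_E) a.e. then Π_E^σ has the same Satake data, so Π_E^σ ≅ Π_E by
Jacquet–Shalika, Π_E = BC(π) by AC Thm 4.2(b), and W⁺ gives ρ_π with ρ_π|_E ≅ ρ|_E by Chebotarev density over E, hence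
ρ_π ≅ ρ ⊗ ε^a (a ∈ {0,1}) by Clifford/Frobenius reciprocity since ρ|_E is irreducible; twist).  Kernels `translation_iff`,
`limK_to_layers`, `layers_to_limK` CERTIFY the sandwich.

WHY THE TRANSLATED SIDE IS EASIER (named tools).  Over the CM layer E, ρ|_E is CONJUGATE-SELF-DUAL UP TO TWIST ((B) + the
c-symmetry), i.e. it is a parameter for unitary groups U(a_v, b_v)_{E/K}, and two engines exist there that have no GL_n/K form:
  (a) VISIBILITY/UNIVERSALITY for POLARISED deformation rings: Allen, «Polarised deformation rings are polynomial over Hecke» (AJM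
      141 (2019), arXiv:1601.03752: big R = 𝕋 in the polarised ordinary setting) and Hellmann–Margerin–Schraen, «Density of
      automorphic points in deformation rings of polarized global Galois representations» (Duke 171 (2022), arXiv:1811.09116),
      on top of the GL_n/CM engines ACC+ §6 (ordinary), Caraiani–Newton — these make the INVISIBLE ghost LI below attackable;
  (b) CLASSICALITY AT THE LIMIT WEIGHT = the non-degenerate-limit COHERENT programme on unitary Shimura varieties: visibility
      Harris 1990 / Su 2018; Galois representations for NDL coherent classes Goldring–Koskivirta (Invent. math. 217 (2019));
      p-adic interpolation and classicality Pilloni «Higher coherent cohomology and p-adic modular forms of singular weights»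
      (Duke 169 (2020)), Boxer–Pilloni «Higher Coleman theory» (arXiv:2110.10251; ALL abelian-type Shimura data; abstract: new
      properties of Galois representations of «certain non-regular algebraic cuspidal automorphic representations»); Taylor–Wiles
      patching for COHERENT cohomology of unitary PEL Shimura varieties in the Lan–Suh range (Harris et al., «The Taylor–Wiles
      method for coherent cohomology, II», AJM 2025, arXiv:2112.06851); the template Boxer–Calegari–Gee–Pilloni (abelian surfaces
      = GSp₄, coherent defect 1).  ONE named missing input: classicality/patching at a limit weight OUTSIDE the Lan–Suh vanishing
      range (coherent defect ≥ 2) — the visible cell LV below is a PROGRAMME cell, not a dark one.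
Neither engine has a counterpart for the 𝕋(K)-visible cell VDK of the host (GL_n over totally real K, l₀ > 0, no polarised
structure used) nor for CMV (strong `Corresponds` at singular weight).

PIECES (route CoherentChamberSplit; `closes hDEG hLV hLI hD hW hF := hF (wildDark_of_pieces hDEG hLV hLI hD hW)`):
  r2 DEG `DegenerateDarkAutomorphy`       crux  DECLARED RESIDUAL · WEAKER (sub-box of SDT: `deg_of_wildDark`; STRICTLY smaller —
     SDT ∖ DEG contains the Calabi–Yau threefolds with h^{2,1} = 2 over K (rank 6 symplectic, HT {0,1,1,2,2,3}: GSp₆ chamber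
     (3/2, 1/2, −1/2) non-degenerate), transcendental lattices of surfaces with p_g = 2 of rank 5–6 (HT {0,1³⁻⁴,2}… mult ≤ 2 only in
     rank 5 with {0,1,1,1,2} excluded — see memo), and every rank ≥ 5 geometric ρ whose base change is a U(a,b)-NDL parameter) ·
     BARRIER NonRegularWeight + ShimuraVarietyRealization HEAD-ON (Gross-degenerate: no Shimura cohomology sees these ρ; or
     not oddly polarisable: no unitary/GSp descent) · IDEA-NEEDED.
  r3 LV  `VisibleLimitLayerAutomorphy`    crux  S-implied (`lv_of_langlands`), UNDECIDED-vs-SDT in strength (different field and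
     dial) · PROGRAMME (inputs (b) above; the missing one is named) · INSTRUMENTABLE (compute coherent H^• of U(2,1)/U(2,2)/GSp₆
     Shimura varieties at limit weights: Goldring–Koskivirta strata Hasse invariants give the Hecke action explicitly).
  r4 LI  `InvisibleLimitLayerAutomorphy`  crux  S-implied (`li_of_langlands`) · ATTACKABLE-BY-ENGINE: show the cell EMPTY — a
     polarised, irreducible, geometric ρ|_E over a CM field E ∋ √-d admits a 𝕋(E)-visible character twist (Allen 2019 / HMS 2022
     density of automorphic points in POLARISED deformation rings; ACC+ Thm 6.1.1 in the ordinary case; Hida theory) — the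
     parity-free ghost, now with the polarisation as an extra handle.
  r9 DSC `LimitLayerDescent`  support  PRINT-ASSEMBLED given W⁺ (AC Thm 4.2(b) + JS + Chebotarev over E + Clifford; NO primitivity,
     NO strong Corresponds, ONE layer) · S-implied trivially (`dsc_of_langlands`) · Lean L.
  r8 W⁺  `SatakeAvatarExistence`  crux  SHARED item stmt-Langlands-17415 (text verbatim = `TameDarkSplit.SatakeAvatarExistence`;
     `Iff.rfl` check below) — consumed by DSC.
  r9 FRAME `WildDarkAutomorphyFrame`  support  SHARED item stmt-Langlands-27423 (text verbatim = `CMLayerSplit.WildDarkAutomorphyFrame`)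
     = host `TameDarkSplit.closes` with hSDT abstracted (`frame_of_host`).
EXACTNESS  `wildDark_iff_cells : SDT ↔ LIMK ∧ DEG` (excluded middle on LIM(ρ)) and `limitLayer_iff_cells : LIMU ↔ LV ∧ LI`
(excluded middle on 𝕋(E)-visibility per (ρ, E)); both disjoint and exhaustive by construction.  DOMINATION  the uncapped host
statement HL∞ (`UncappedHolomorphicLimitAutomorphy`, node-only = HL_TR 32003 minus `n ≤ 4`) gives both HL_TR and LIMK
(`hl_of_uncappedHL`, `limK_of_uncappedHL`): the coherent cell is exactly «HL_TR beyond rank 4 on the dark box».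
-/

set_option linter.dupNamespace false

namespace Summit.Langlands.Langlands.Theorems.TameDarkSplitCoherentChamber

open Filter

/-! ## Route items (statements byte-identical to `nodes/lens-3-g13-CoherentChamberSplit.childroute.route.json`) -/

/-- crux (rank 2) — DEG, the DECLARED RESIDUAL: the members of the wild dark box that are NOT of uncapped limit type (no totally-odd-signed polarisation, or some labelled Hodge–Tate weight of multiplicity ≥ 3, or HT-regular — the last sub-cell is empty inside the box) are weakly automorphic.  Gross-degenerate / non-polarisable dark representations: invisible to every Shimura cohomology.  WEAKER than SDT (sub-box). -/
def DegenerateDarkAutomorphy : Prop :=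
  ∀ (K : Type) [Field K] [NumberField K], NumberField.IsTotallyReal K → ∀ (n : ℕ) (hcpt : Literature.NumberTheory.Automorphic.isCompact_glFiniteIntegralLevel n K), 0 < n → ∀ (ℓ : ℕ) [Fact ℓ.Prime] (ι : PadicAlgCl ℓ ≃+* ℂ) (ρ : Literature.NumberTheory.GaloisRepresentations.FramedGaloisRep K (PadicAlgCl ℓ) n), ρ.toGaloisRep.IsIrreducible → ((∀ᶠ v : IsDedekindDomain.HeightOneSpectrum (NumberField.RingOfIntegers K) in Filter.cofinite, ρ.IsUnramifiedAt v) ∧ ∀ (v : IsDedekindDomain.HeightOneSpectrum (NumberField.RingOfIntegers K)) (hv : ((ℓ : ℕ) : NumberField.RingOfIntegers K) ∈ v.asIdeal), (Literature.NumberTheory.PAdicHodge.fontainePstAdicCompletion v ℓ hv).IsDeRhamFramed (ρ.toLocal v)) → ¬ (∃ (M E₀ : Type) (_ : Field M) (_ : NumberField M) (_ : Field E₀) (_ : NumberField E₀) (_ : Algebra K M) (_ : Algebra M E₀) (_ : Algebra K E₀) (_ : IsScalarTower K M E₀) (_ : IsGalois K E₀), IsSolvable (E₀ ≃ₐ[K]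 E₀) ∧ ∃ (F₁ E₁ : Type) (_ : Field F₁) (_ : NumberField F₁) (_ : Field E₁) (_ : NumberField E₁) (_ : Algebra F₁ M) (_ : Algebra M E₁) (_ : Algebra F₁ E₁) (_ : IsScalarTower F₁ M E₁) (_ : IsGalois F₁ E₁), NumberField.IsTotallyReal F₁ ∧ IsSolvable (E₁ ≃ₐ[F₁] E₁) ∧ ∃ (m : ℕ) (θ : Literature.NumberTheory.GaloisRepresentations.FramedGaloisRep M (PadicAlgCl ℓ) m), 0 < m ∧ θ.toGaloisRep.IsIrreducible ∧ (∃ (mc : ℕ) (θc : Literature.NumberTheory.GaloisRepresentations.FramedGaloisRep M (PadicAlgCl ℓ) mc), ∀ g : Field.absoluteGaloisGroup M, Literature.NumberTheory.GaloisRepresentations.FramedRep.trace (ρ.restrictField M) g = Literature.NumberTheory.GaloisRepresentations.FramedRep.trace θ g + Literature.NumberTheory.GaloisRepresentations.FramedRep.trace θc g) ∧ ∃ (χ : Literature.NumberTheory.GaloisRepresentations.FramedGaloisRep M (PadicAlgCl ℓ) 1) (n' : ℕ) (R' : Literature.NumberTheory.GaloisRepresentations.FramedGaloisRep F₁ (PadicAlgCl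 ℓ) n'), 0 < n' ∧ R'.toGaloisRep.IsIrreducible ∧ ((∀ᶠ v : IsDedekindDomain.HeightOneSpectrum (NumberField.RingOfIntegers F₁) in Filter.cofinite, R'.IsUnramifiedAt v) ∧ ∀ (v : IsDedekindDomain.HeightOneSpectrum (NumberField.RingOfIntegers F₁)) (hv : ((ℓ : ℕ) : NumberField.RingOfIntegers F₁) ∈ v.asIdeal), (Literature.NumberTheory.PAdicHodge.fontainePstAdicCompletion v ℓ hv).IsDeRhamFramed (R'.toLocal v)) ∧ ((∀ (v : IsDedekindDomain.HeightOneSpectrum (NumberField.RingOfIntegers F₁)) (hv : ((ℓ : ℕ) : NumberField.RingOfIntegers F₁) ∈ v.asIdeal), ∀ τ : v.adicCompletion F₁ →+* PadicAlgCl ℓ, Continuous τ → (R'.labelledHodgeTateWeightsAt v (Literature.NumberTheory.PAdicHodge.fontainePstAdicCompletion v ℓ hv).algebra (Literature.NumberTheory.PAdicHodge.fontainePstAdicCompletion v ℓ hv).𝔅 τ).Nodup) ∨ (n' ≤ 4 ∧ (∃ B : Matrix (Fin n') (Fin n') (PadicAlgCl ℓ), B.det ≠ 0 ∧ (Matrix.transpose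 B = B ∨ Matrix.transpose B = -B) ∧ (∀ g : Field.absoluteGaloisGroup F₁, ∃ s : PadicAlgCl ℓ, Matrix.transpose ((R' g : GL (Fin n') (PadicAlgCl ℓ)) : Matrix (Fin n') (Fin n') (PadicAlgCl ℓ)) * B * ((R' g : GL (Fin n') (PadicAlgCl ℓ)) : Matrix (Fin n') (Fin n') (PadicAlgCl ℓ)) = s • B) ∧ ∀ (φ : F₁ →+* ℝ) (c : Field.absoluteGaloisGroup F₁), Literature.NumberTheory.GaloisRepresentations.IsComplexConjugation φ c → Matrix.transpose (B * ((R' c : GL (Fin n') (PadicAlgCl ℓ)) : Matrix (Fin n') (Fin n') (PadicAlgCl ℓ))) = B * ((R' c : GL (Fin n') (PadicAlgCl ℓ)) : Matrix (Fin n') (Fin n') (PadicAlgCl ℓ))) ∧ (∀ (v : IsDedekindDomain.HeightOneSpectrum (NumberField.RingOfIntegers F₁)) (hv : ((ℓ : ℕ) : NumberField.RingOfIntegers F₁) ∈ v.asIdeal), ∀ τ : v.adicCompletion F₁ →+* PadicAlgCl ℓ, Continuous τ → ∀ w : ℤ, Multiset.count w (R'.labelledHodgeTateWeightsAt v (Literature.NumberTheory.PAdicHodge.fontainePstAdicCompletion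 v ℓ hv).algebra (Literature.NumberTheory.PAdicHodge.fontainePstAdicCompletion v ℓ hv).𝔅 τ) ≤ 2)) ∨ (Set.range fun g : Field.absoluteGaloisGroup F₁ => (R' g : GL (Fin n') (PadicAlgCl ℓ))).Finite) ∧ (∃ (mc' : ℕ) (θc' : Literature.NumberTheory.GaloisRepresentations.FramedGaloisRep M (PadicAlgCl ℓ) mc'), ∀ g : Field.absoluteGaloisGroup M, Literature.NumberTheory.GaloisRepresentations.FramedRep.trace (R'.restrictField M) g = Literature.NumberTheory.GaloisRepresentations.FramedRep.trace χ g * Literature.NumberTheory.GaloisRepresentations.FramedRep.trace θ g + Literature.NumberTheory.GaloisRepresentations.FramedRep.trace θc' g)) → ¬ (∃ (M E₀ : Type) (_ : Field M) (_ : NumberField M) (_ : Field E₀) (_ : NumberField E₀) (_ : Algebra K M) (_ : Algebra M E₀) (_ : Algebra K E₀) (_ : IsScalarTower K M E₀) (_ : IsGalois K E₀), IsSolvable (E₀ ≃ₐ[K] E₀) ∧ ∃ (F₁ E₁ : Type) (_ : Field F₁) (_ : NumberField F₁) (_ : Field E₁) (_ : NumberField E₁) (_ : Algebra F₁ M) (_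 : Algebra M E₁) (_ : Algebra F₁ E₁) (_ : IsScalarTower F₁ M E₁) (_ : IsGalois F₁ E₁), NumberField.IsTotallyReal F₁ ∧ IsSolvable (E₁ ≃ₐ[F₁] E₁) ∧ ∃ (m : ℕ) (θ : Literature.NumberTheory.GaloisRepresentations.FramedGaloisRep M (PadicAlgCl ℓ) m), 0 < m ∧ θ.toGaloisRep.IsIrreducible ∧ (∃ (mc : ℕ) (θc : Literature.NumberTheory.GaloisRepresentations.FramedGaloisRep M (PadicAlgCl ℓ) mc), ∀ g : Field.absoluteGaloisGroup M, Literature.NumberTheory.GaloisRepresentations.FramedRep.trace (ρ.restrictField M) g = Literature.NumberTheory.GaloisRepresentations.FramedRep.trace θ g + Literature.NumberTheory.GaloisRepresentations.FramedRep.trace θc g) ∧ ∃ (χ : Literature.NumberTheory.GaloisRepresentations.FramedGaloisRep M (PadicAlgCl ℓ) 1) (n' : ℕ) (R' : Literature.NumberTheory.GaloisRepresentations.FramedGaloisRep F₁ (PadicAlgCl ℓ) n'), 0 < n' ∧ R'.toGaloisRep.IsIrreducible ∧ ((∀ᶠ v : IsDedekindDomain.HeightOneSpectrum (NumberField.RingOfIntegers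 F₁) in Filter.cofinite, R'.IsUnramifiedAt v) ∧ ∀ (v : IsDedekindDomain.HeightOneSpectrum (NumberField.RingOfIntegers F₁)) (hv : ((ℓ : ℕ) : NumberField.RingOfIntegers F₁) ∈ v.asIdeal), (Literature.NumberTheory.PAdicHodge.fontainePstAdicCompletion v ℓ hv).IsDeRhamFramed (R'.toLocal v)) ∧ (∃ (L : Type) (_ : Field L) (_ : NumberField L) (_ : Algebra F₁ L), ∀ (w : IsDedekindDomain.HeightOneSpectrum (NumberField.RingOfIntegers L)), ((ℓ : ℕ) : NumberField.RingOfIntegers L) ∈ w.asIdeal → (R'.restrictField L).IsUnramifiedAt w) ∧ (∃ (mc' : ℕ) (θc' : Literature.NumberTheory.GaloisRepresentations.FramedGaloisRep M (PadicAlgCl ℓ) mc'), ∀ g : Field.absoluteGaloisGroup M, Literature.NumberTheory.GaloisRepresentations.FramedRep.trace (R'.restrictField M) g = Literature.NumberTheory.GaloisRepresentations.FramedRep.trace χ g * Literature.NumberTheory.GaloisRepresentations.FramedRep.trace θ g + Literature.NumberTheory.GaloisRepresentations.FramedRep.trace θc' g)) → ¬ ((∃ B : Matrix (Fin n) (Fin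 n) (PadicAlgCl ℓ), B.det ≠ 0 ∧ (Matrix.transpose B = B ∨ Matrix.transpose B = -B) ∧ (∀ g : Field.absoluteGaloisGroup K, ∃ s : PadicAlgCl ℓ, Matrix.transpose ((ρ g : GL (Fin n) (PadicAlgCl ℓ)) : Matrix (Fin n) (Fin n) (PadicAlgCl ℓ)) * B * ((ρ g : GL (Fin n) (PadicAlgCl ℓ)) : Matrix (Fin n) (Fin n) (PadicAlgCl ℓ)) = s • B) ∧ ∀ (φ : K →+* ℝ) (c : Field.absoluteGaloisGroup K), Literature.NumberTheory.GaloisRepresentations.IsComplexConjugation φ c → Matrix.transpose (B * ((ρ c : GL (Fin n) (PadicAlgCl ℓ)) : Matrix (Fin n) (Fin n) (PadicAlgCl ℓ))) = B * ((ρ c : GL (Fin n) (PadicAlgCl ℓ)) : Matrix (Fin n) (Fin n) (PadicAlgCl ℓ))) ∧ (∀ (v : IsDedekindDomain.HeightOneSpectrum (NumberField.RingOfIntegers K)) (hv : ((ℓ : ℕ) : NumberField.RingOfIntegers K) ∈ v.asIdeal), ∀ τ : v.adicCompletion K →+* PadicAlgCl ℓ, Continuous τ → ∀ w : ℤ, Multiset.count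 w (ρ.labelledHodgeTateWeightsAt v (Literature.NumberTheory.PAdicHodge.fontainePstAdicCompletion v ℓ hv).algebra (Literature.NumberTheory.PAdicHodge.fontainePstAdicCompletion v ℓ hv).𝔅 τ) ≤ 2) ∧ ¬ (∀ (v : IsDedekindDomain.HeightOneSpectrum (NumberField.RingOfIntegers K)) (hv : ((ℓ : ℕ) : NumberField.RingOfIntegers K) ∈ v.asIdeal), ∀ τ : v.adicCompletion K →+* PadicAlgCl ℓ, Continuous τ → (ρ.labelledHodgeTateWeightsAt v (Literature.NumberTheory.PAdicHodge.fontainePstAdicCompletion v ℓ hv).algebra (Literature.NumberTheory.PAdicHodge.fontainePstAdicCompletion v ℓ hv).𝔅 τ).Nodup)) → ∃ π : Literature.NumberTheory.Automorphic.CuspidalAutomorphicRepData n K hcpt, π.1.IsLAlgebraic ∧ ∀ᶠ v : IsDedekindDomain.HeightOneSpectrum (NumberField.RingOfIntegers K) in Filter.cofinite, SatakeFrobCompatibleAt ι π.1 ρ v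

/-- crux (rank 3) — LV: for ρ in the wild dark box of uncapped limit type (oddly polarised, HT multiplicities ≤ 2, not HT-regular) and every CM quadratic layer E ∋ √-d on which ρ|_E is irreducible and pinned-geometric, IF a character twist of ρ|_E is 𝕋(E)-VISIBLE (p-adically automorphic of some tame level of GL_n/E) THEN ρ|_E is WEAKLY automorphic over E (cuspidal L-algebraic Π_E, Satake = Frobenius a.e.).  Limit-weight CLASSICALITY: the non-degenerate-limit coherent programme on U(a,b) Shimura varieties. -/
def VisibleLimitLayerAutomorphy : Prop :=
  ∀ (K : Type) [Field K] [NumberField K], NumberField.IsTotallyReal K → ∀ (n : ℕ) (hcpt : Literature.NumberTheory.Automorphic.isCompact_glFiniteIntegralLevel n K), 0 < n → ∀ (ℓ : ℕ) [Fact ℓ.Prime] (ι : PadicAlgCl ℓ ≃+* ℂ) (ρ : Literature.NumberTheory.GaloisRepresentations.FramedGaloisRep K (PadicAlgCl ℓ) n), ρ.toGaloisRep.IsIrreducible → ((∀ᶠ v : IsDedekindDomain.HeightOneSpectrum (NumberField.RingOfIntegers K) in Filter.cofinite, ρ.IsUnramifiedAt v) ∧ ∀ (v : IsDedekindDomain.HeightOneSpectrum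 (NumberField.RingOfIntegers K)) (hv : ((ℓ : ℕ) : NumberField.RingOfIntegers K) ∈ v.asIdeal), (Literature.NumberTheory.PAdicHodge.fontainePstAdicCompletion v ℓ hv).IsDeRhamFramed (ρ.toLocal v)) → ¬ (∃ (M E₀ : Type) (_ : Field M) (_ : NumberField M) (_ : Field E₀) (_ : NumberField E₀) (_ : Algebra K M) (_ : Algebra M E₀) (_ : Algebra K E₀) (_ : IsScalarTower K M E₀) (_ : IsGalois K E₀), IsSolvable (E₀ ≃ₐ[K] E₀) ∧ ∃ (F₁ E₁ : Type) (_ : Field F₁) (_ : NumberField F₁) (_ : Field E₁) (_ : NumberField E₁) (_ : Algebra F₁ M) (_ : Algebra M E₁) (_ : Algebra F₁ E₁) (_ : IsScalarTower F₁ M E₁) (_ : IsGalois F₁ E₁), NumberField.IsTotallyReal F₁ ∧ IsSolvable (E₁ ≃ₐ[F₁] E₁) ∧ ∃ (m : ℕ) (θ : Literature.NumberTheory.GaloisRepresentations.FramedGaloisRep M (PadicAlgCl ℓ) m), 0 < m ∧ θ.toGaloisRep.IsIrreducible ∧ (∃ (mc : ℕ) (θc : Literature.NumberTheory.GaloisRepresentations.FramedGaloisRep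 M (PadicAlgCl ℓ) mc), ∀ g : Field.absoluteGaloisGroup M, Literature.NumberTheory.GaloisRepresentations.FramedRep.trace (ρ.restrictField M) g = Literature.NumberTheory.GaloisRepresentations.FramedRep.trace θ g + Literature.NumberTheory.GaloisRepresentations.FramedRep.trace θc g) ∧ ∃ (χ : Literature.NumberTheory.GaloisRepresentations.FramedGaloisRep M (PadicAlgCl ℓ) 1) (n' : ℕ) (R' : Literature.NumberTheory.GaloisRepresentations.FramedGaloisRep F₁ (PadicAlgCl ℓ) n'), 0 < n' ∧ R'.toGaloisRep.IsIrreducible ∧ ((∀ᶠ v : IsDedekindDomain.HeightOneSpectrum (NumberField.RingOfIntegers F₁) in Filter.cofinite, R'.IsUnramifiedAt v) ∧ ∀ (v : IsDedekindDomain.HeightOneSpectrum (NumberField.RingOfIntegers F₁)) (hv : ((ℓ : ℕ) : NumberField.RingOfIntegers F₁) ∈ v.asIdeal), (Literature.NumberTheory.PAdicHodge.fontainePstAdicCompletion v ℓ hv).IsDeRhamFramed (R'.toLocal v)) ∧ ((∀ (v : IsDedekindDomain.HeightOneSpectrum (NumberField.RingOfIntegers F₁)) (hv : ((ℓ : ℕ)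 : NumberField.RingOfIntegers F₁) ∈ v.asIdeal), ∀ τ : v.adicCompletion F₁ →+* PadicAlgCl ℓ, Continuous τ → (R'.labelledHodgeTateWeightsAt v (Literature.NumberTheory.PAdicHodge.fontainePstAdicCompletion v ℓ hv).algebra (Literature.NumberTheory.PAdicHodge.fontainePstAdicCompletion v ℓ hv).𝔅 τ).Nodup) ∨ (n' ≤ 4 ∧ (∃ B : Matrix (Fin n') (Fin n') (PadicAlgCl ℓ), B.det ≠ 0 ∧ (Matrix.transpose B = B ∨ Matrix.transpose B = -B) ∧ (∀ g : Field.absoluteGaloisGroup F₁, ∃ s : PadicAlgCl ℓ, Matrix.transpose ((R' g : GL (Fin n') (PadicAlgCl ℓ)) : Matrix (Fin n') (Fin n') (PadicAlgCl ℓ)) * B * ((R' g : GL (Fin n') (PadicAlgCl ℓ)) : Matrix (Fin n') (Fin n') (PadicAlgCl ℓ)) = s • B) ∧ ∀ (φ : F₁ →+* ℝ) (c : Field.absoluteGaloisGroup F₁), Literature.NumberTheory.GaloisRepresentations.IsComplexConjugation φ c → Matrix.transpose (B * ((R' c : GL (Fin n') (PadicAlgCl ℓ)) : Matrix (Fin n')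 (Fin n') (PadicAlgCl ℓ))) = B * ((R' c : GL (Fin n') (PadicAlgCl ℓ)) : Matrix (Fin n') (Fin n') (PadicAlgCl ℓ))) ∧ (∀ (v : IsDedekindDomain.HeightOneSpectrum (NumberField.RingOfIntegers F₁)) (hv : ((ℓ : ℕ) : NumberField.RingOfIntegers F₁) ∈ v.asIdeal), ∀ τ : v.adicCompletion F₁ →+* PadicAlgCl ℓ, Continuous τ → ∀ w : ℤ, Multiset.count w (R'.labelledHodgeTateWeightsAt v (Literature.NumberTheory.PAdicHodge.fontainePstAdicCompletion v ℓ hv).algebra (Literature.NumberTheory.PAdicHodge.fontainePstAdicCompletion v ℓ hv).𝔅 τ) ≤ 2)) ∨ (Set.range fun g : Field.absoluteGaloisGroup F₁ => (R' g : GL (Fin n') (PadicAlgCl ℓ))).Finite) ∧ (∃ (mc' : ℕ) (θc' : Literature.NumberTheory.GaloisRepresentations.FramedGaloisRep M (PadicAlgCl ℓ) mc'), ∀ g : Field.absoluteGaloisGroup M, Literature.NumberTheory.GaloisRepresentations.FramedRep.trace (R'.restrictField M) g = Literature.NumberTheory.GaloisRepresentations.FramedRep.trace χ g * Literature.NumberTheory.GaloisRepresentations.FramedRep.trace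 θ g + Literature.NumberTheory.GaloisRepresentations.FramedRep.trace θc' g)) → ¬ (∃ (M E₀ : Type) (_ : Field M) (_ : NumberField M) (_ : Field E₀) (_ : NumberField E₀) (_ : Algebra K M) (_ : Algebra M E₀) (_ : Algebra K E₀) (_ : IsScalarTower K M E₀) (_ : IsGalois K E₀), IsSolvable (E₀ ≃ₐ[K] E₀) ∧ ∃ (F₁ E₁ : Type) (_ : Field F₁) (_ : NumberField F₁) (_ : Field E₁) (_ : NumberField E₁) (_ : Algebra F₁ M) (_ : Algebra M E₁) (_ : Algebra F₁ E₁) (_ : IsScalarTower F₁ M E₁) (_ : IsGalois F₁ E₁), NumberField.IsTotallyReal F₁ ∧ IsSolvable (E₁ ≃ₐ[F₁] E₁) ∧ ∃ (m : ℕ) (θ : Literature.NumberTheory.GaloisRepresentations.FramedGaloisRep M (PadicAlgCl ℓ) m), 0 < m ∧ θ.toGaloisRep.IsIrreducible ∧ (∃ (mc : ℕ) (θc : Literature.NumberTheory.GaloisRepresentations.FramedGaloisRep M (PadicAlgCl ℓ) mc), ∀ g : Field.absoluteGaloisGroup M, Literature.NumberTheory.GaloisRepresentations.FramedRep.trace (ρ.restrictField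 M) g = Literature.NumberTheory.GaloisRepresentations.FramedRep.trace θ g + Literature.NumberTheory.GaloisRepresentations.FramedRep.trace θc g) ∧ ∃ (χ : Literature.NumberTheory.GaloisRepresentations.FramedGaloisRep M (PadicAlgCl ℓ) 1) (n' : ℕ) (R' : Literature.NumberTheory.GaloisRepresentations.FramedGaloisRep F₁ (PadicAlgCl ℓ) n'), 0 < n' ∧ R'.toGaloisRep.IsIrreducible ∧ ((∀ᶠ v : IsDedekindDomain.HeightOneSpectrum (NumberField.RingOfIntegers F₁) in Filter.cofinite, R'.IsUnramifiedAt v) ∧ ∀ (v : IsDedekindDomain.HeightOneSpectrum (NumberField.RingOfIntegers F₁)) (hv : ((ℓ : ℕ) : NumberField.RingOfIntegers F₁) ∈ v.asIdeal), (Literature.NumberTheory.PAdicHodge.fontainePstAdicCompletion v ℓ hv).IsDeRhamFramed (R'.toLocal v)) ∧ (∃ (L : Type) (_ : Field L) (_ : NumberField L) (_ : Algebra F₁ L), ∀ (w : IsDedekindDomain.HeightOneSpectrum (NumberField.RingOfIntegers L)), ((ℓ : ℕ) : NumberField.RingOfIntegers L) ∈ w.asIdeal → (R'.restrictField L).IsUnramifiedAt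 w) ∧ (∃ (mc' : ℕ) (θc' : Literature.NumberTheory.GaloisRepresentations.FramedGaloisRep M (PadicAlgCl ℓ) mc'), ∀ g : Field.absoluteGaloisGroup M, Literature.NumberTheory.GaloisRepresentations.FramedRep.trace (R'.restrictField M) g = Literature.NumberTheory.GaloisRepresentations.FramedRep.trace χ g * Literature.NumberTheory.GaloisRepresentations.FramedRep.trace θ g + Literature.NumberTheory.GaloisRepresentations.FramedRep.trace θc' g)) → (∃ B : Matrix (Fin n) (Fin n) (PadicAlgCl ℓ), B.det ≠ 0 ∧ (Matrix.transpose B = B ∨ Matrix.transpose B = -B) ∧ (∀ g : Field.absoluteGaloisGroup K, ∃ s : PadicAlgCl ℓ, Matrix.transpose ((ρ g : GL (Fin n) (PadicAlgCl ℓ)) : Matrix (Fin n) (Fin n) (PadicAlgCl ℓ)) * B * ((ρ g : GL (Fin n) (PadicAlgCl ℓ)) : Matrix (Fin n) (Fin n) (PadicAlgCl ℓ)) = s • B) ∧ ∀ (φ : K →+* ℝ) (c : Field.absoluteGaloisGroup K), Literature.NumberTheory.GaloisRepresentations.IsComplexConjugation φ c → Matrix.transpose (B * ((ρ c : GL (Fin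 n) (PadicAlgCl ℓ)) : Matrix (Fin n) (Fin n) (PadicAlgCl ℓ))) = B * ((ρ c : GL (Fin n) (PadicAlgCl ℓ)) : Matrix (Fin n) (Fin n) (PadicAlgCl ℓ))) → (∀ (v : IsDedekindDomain.HeightOneSpectrum (NumberField.RingOfIntegers K)) (hv : ((ℓ : ℕ) : NumberField.RingOfIntegers K) ∈ v.asIdeal), ∀ τ : v.adicCompletion K →+* PadicAlgCl ℓ, Continuous τ → ∀ w : ℤ, Multiset.count w (ρ.labelledHodgeTateWeightsAt v (Literature.NumberTheory.PAdicHodge.fontainePstAdicCompletion v ℓ hv).algebra (Literature.NumberTheory.PAdicHodge.fontainePstAdicCompletion v ℓ hv).𝔅 τ) ≤ 2) → ¬ (∀ (v : IsDedekindDomain.HeightOneSpectrum (NumberField.RingOfIntegers K)) (hv : ((ℓ : ℕ) : NumberField.RingOfIntegers K) ∈ v.asIdeal), ∀ τ : v.adicCompletion K →+* PadicAlgCl ℓ, Continuous τ → (ρ.labelledHodgeTateWeightsAt v (Literature.NumberTheory.PAdicHodge.fontainePstAdicCompletion v ℓ hv).algebra (Literature.NumberTheory.PAdicHodge.fontainePstAdicCompletion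 v ℓ hv).𝔅 τ).Nodup) → ∀ (E : Type) [Field E] [NumberField E] [Algebra K E], NumberField.IsCMField E → Module.finrank K E = 2 → (∃ d : ℕ, 0 < d ∧ ∃ x : E, x * x = -(d : E)) → (ρ.restrictField E).toGaloisRep.IsIrreducible → ∀ (𝓡E : Summit.Langlands.ReciprocityData E), Summit.Langlands.IsGeometricFramed 𝓡E (ρ.restrictField E) → (∃ (χ : Literature.NumberTheory.GaloisRepresentations.FramedGaloisRep E (PadicAlgCl ℓ) 1) (R : Literature.NumberTheory.GaloisRepresentations.FramedGaloisRep E (PadicAlgCl ℓ) n), (∀ g : Field.absoluteGaloisGroup E, Literature.NumberTheory.GaloisRepresentations.FramedRep.trace R g = Literature.NumberTheory.GaloisRepresentations.FramedRep.trace χ g * Literature.NumberTheory.GaloisRepresentations.FramedRep.trace (ρ.restrictField E) g) ∧ ∃ 𝒰 : Literature.NumberTheory.Automorphic.BigHeckeGLn.TameLevel n E ℓ, 𝒰.IsPadicallyAutomorphic R) → ∀ (hcptE : Literature.NumberTheory.Automorphic.isCompact_glFiniteIntegralLevel n E), ∃ π : Literature.NumberTheory.Automorphic.CuspidalAutomorphicRepData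 n E hcptE, π.1.IsLAlgebraic ∧ ∀ᶠ w : IsDedekindDomain.HeightOneSpectrum (NumberField.RingOfIntegers E) in Filter.cofinite, SatakeFrobCompatibleAt ι π.1 (ρ.restrictField E) w

/-- crux (rank 4) — LI: the complementary cell — ρ in the wild dark box of uncapped limit type, CM quadratic layer E as in LV, NO character twist of ρ|_E 𝕋(E)-visible at any tame level — is weakly automorphic over E.  The parity-free POLARISED ghost: conjecturally EMPTY (density of automorphic points in polarised deformation rings; ACC+ ordinary). -/
def InvisibleLimitLayerAutomorphy : Prop :=
  ∀ (K : Type) [Field K] [NumberField K], NumberField.IsTotallyReal K → ∀ (n : ℕ) (hcpt : Literature.NumberTheory.Automorphic.isCompact_glFiniteIntegralLevel n K), 0 < n → ∀ (ℓ : ℕ) [Fact ℓ.Prime] (ι : PadicAlgCl ℓ ≃+* ℂ) (ρ : Literature.NumberTheory.GaloisRepresentations.FramedGaloisRep K (PadicAlgCl ℓ) n), ρ.toGaloisRep.IsIrreducible → ((∀ᶠ v : IsDedekindDomain.HeightOneSpectrum (NumberField.RingOfIntegers K) in Filter.cofinite, ρ.IsUnramifiedAt v) ∧ ∀ (v : IsDedekindDomain.HeightOneSpectrum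 (NumberField.RingOfIntegers K)) (hv : ((ℓ : ℕ) : NumberField.RingOfIntegers K) ∈ v.asIdeal), (Literature.NumberTheory.PAdicHodge.fontainePstAdicCompletion v ℓ hv).IsDeRhamFramed (ρ.toLocal v)) → ¬ (∃ (M E₀ : Type) (_ : Field M) (_ : NumberField M) (_ : Field E₀) (_ : NumberField E₀) (_ : Algebra K M) (_ : Algebra M E₀) (_ : Algebra K E₀) (_ : IsScalarTower K M E₀) (_ : IsGalois K E₀), IsSolvable (E₀ ≃ₐ[K] E₀) ∧ ∃ (F₁ E₁ : Type) (_ : Field F₁) (_ : NumberField F₁) (_ : Field E₁) (_ : NumberField E₁) (_ : Algebra F₁ M) (_ : Algebra M E₁) (_ : Algebra F₁ E₁) (_ : IsScalarTower F₁ M E₁) (_ : IsGalois F₁ E₁), NumberField.IsTotallyReal F₁ ∧ IsSolvable (E₁ ≃ₐ[F₁] E₁) ∧ ∃ (m : ℕ) (θ : Literature.NumberTheory.GaloisRepresentations.FramedGaloisRep M (PadicAlgCl ℓ) m), 0 < m ∧ θ.toGaloisRep.IsIrreducible ∧ (∃ (mc : ℕ) (θc : Literature.NumberTheory.GaloisRepresentations.FramedGaloisRep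 M (PadicAlgCl ℓ) mc), ∀ g : Field.absoluteGaloisGroup M, Literature.NumberTheory.GaloisRepresentations.FramedRep.trace (ρ.restrictField M) g = Literature.NumberTheory.GaloisRepresentations.FramedRep.trace θ g + Literature.NumberTheory.GaloisRepresentations.FramedRep.trace θc g) ∧ ∃ (χ : Literature.NumberTheory.GaloisRepresentations.FramedGaloisRep M (PadicAlgCl ℓ) 1) (n' : ℕ) (R' : Literature.NumberTheory.GaloisRepresentations.FramedGaloisRep F₁ (PadicAlgCl ℓ) n'), 0 < n' ∧ R'.toGaloisRep.IsIrreducible ∧ ((∀ᶠ v : IsDedekindDomain.HeightOneSpectrum (NumberField.RingOfIntegers F₁) in Filter.cofinite, R'.IsUnramifiedAt v) ∧ ∀ (v : IsDedekindDomain.HeightOneSpectrum (NumberField.RingOfIntegers F₁)) (hv : ((ℓ : ℕ) : NumberField.RingOfIntegers F₁) ∈ v.asIdeal), (Literature.NumberTheory.PAdicHodge.fontainePstAdicCompletion v ℓ hv).IsDeRhamFramed (R'.toLocal v)) ∧ ((∀ (v : IsDedekindDomain.HeightOneSpectrum (NumberField.RingOfIntegers F₁)) (hv : ((ℓ : ℕ)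 : NumberField.RingOfIntegers F₁) ∈ v.asIdeal), ∀ τ : v.adicCompletion F₁ →+* PadicAlgCl ℓ, Continuous τ → (R'.labelledHodgeTateWeightsAt v (Literature.NumberTheory.PAdicHodge.fontainePstAdicCompletion v ℓ hv).algebra (Literature.NumberTheory.PAdicHodge.fontainePstAdicCompletion v ℓ hv).𝔅 τ).Nodup) ∨ (n' ≤ 4 ∧ (∃ B : Matrix (Fin n') (Fin n') (PadicAlgCl ℓ), B.det ≠ 0 ∧ (Matrix.transpose B = B ∨ Matrix.transpose B = -B) ∧ (∀ g : Field.absoluteGaloisGroup F₁, ∃ s : PadicAlgCl ℓ, Matrix.transpose ((R' g : GL (Fin n') (PadicAlgCl ℓ)) : Matrix (Fin n') (Fin n') (PadicAlgCl ℓ)) * B * ((R' g : GL (Fin n') (PadicAlgCl ℓ)) : Matrix (Fin n') (Fin n') (PadicAlgCl ℓ)) = s • B) ∧ ∀ (φ : F₁ →+* ℝ) (c : Field.absoluteGaloisGroup F₁), Literature.NumberTheory.GaloisRepresentations.IsComplexConjugation φ c → Matrix.transpose (B * ((R' c : GL (Fin n') (PadicAlgCl ℓ)) : Matrix (Fin n')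 (Fin n') (PadicAlgCl ℓ))) = B * ((R' c : GL (Fin n') (PadicAlgCl ℓ)) : Matrix (Fin n') (Fin n') (PadicAlgCl ℓ))) ∧ (∀ (v : IsDedekindDomain.HeightOneSpectrum (NumberField.RingOfIntegers F₁)) (hv : ((ℓ : ℕ) : NumberField.RingOfIntegers F₁) ∈ v.asIdeal), ∀ τ : v.adicCompletion F₁ →+* PadicAlgCl ℓ, Continuous τ → ∀ w : ℤ, Multiset.count w (R'.labelledHodgeTateWeightsAt v (Literature.NumberTheory.PAdicHodge.fontainePstAdicCompletion v ℓ hv).algebra (Literature.NumberTheory.PAdicHodge.fontainePstAdicCompletion v ℓ hv).𝔅 τ) ≤ 2)) ∨ (Set.range fun g : Field.absoluteGaloisGroup F₁ => (R' g : GL (Fin n') (PadicAlgCl ℓ))).Finite) ∧ (∃ (mc' : ℕ) (θc' : Literature.NumberTheory.GaloisRepresentations.FramedGaloisRep M (PadicAlgCl ℓ) mc'), ∀ g : Field.absoluteGaloisGroup M, Literature.NumberTheory.GaloisRepresentations.FramedRep.trace (R'.restrictField M) g = Literature.NumberTheory.GaloisRepresentations.FramedRep.trace χ g * Literature.NumberTheory.GaloisRepresentations.FramedRep.trace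 θ g + Literature.NumberTheory.GaloisRepresentations.FramedRep.trace θc' g)) → ¬ (∃ (M E₀ : Type) (_ : Field M) (_ : NumberField M) (_ : Field E₀) (_ : NumberField E₀) (_ : Algebra K M) (_ : Algebra M E₀) (_ : Algebra K E₀) (_ : IsScalarTower K M E₀) (_ : IsGalois K E₀), IsSolvable (E₀ ≃ₐ[K] E₀) ∧ ∃ (F₁ E₁ : Type) (_ : Field F₁) (_ : NumberField F₁) (_ : Field E₁) (_ : NumberField E₁) (_ : Algebra F₁ M) (_ : Algebra M E₁) (_ : Algebra F₁ E₁) (_ : IsScalarTower F₁ M E₁) (_ : IsGalois F₁ E₁), NumberField.IsTotallyReal F₁ ∧ IsSolvable (E₁ ≃ₐ[F₁] E₁) ∧ ∃ (m : ℕ) (θ : Literature.NumberTheory.GaloisRepresentations.FramedGaloisRep M (PadicAlgCl ℓ) m), 0 < m ∧ θ.toGaloisRep.IsIrreducible ∧ (∃ (mc : ℕ) (θc : Literature.NumberTheory.GaloisRepresentations.FramedGaloisRep M (PadicAlgCl ℓ) mc), ∀ g : Field.absoluteGaloisGroup M, Literature.NumberTheory.GaloisRepresentations.FramedRep.trace (ρ.restrictField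 M) g = Literature.NumberTheory.GaloisRepresentations.FramedRep.trace θ g + Literature.NumberTheory.GaloisRepresentations.FramedRep.trace θc g) ∧ ∃ (χ : Literature.NumberTheory.GaloisRepresentations.FramedGaloisRep M (PadicAlgCl ℓ) 1) (n' : ℕ) (R' : Literature.NumberTheory.GaloisRepresentations.FramedGaloisRep F₁ (PadicAlgCl ℓ) n'), 0 < n' ∧ R'.toGaloisRep.IsIrreducible ∧ ((∀ᶠ v : IsDedekindDomain.HeightOneSpectrum (NumberField.RingOfIntegers F₁) in Filter.cofinite, R'.IsUnramifiedAt v) ∧ ∀ (v : IsDedekindDomain.HeightOneSpectrum (NumberField.RingOfIntegers F₁)) (hv : ((ℓ : ℕ) : NumberField.RingOfIntegers F₁) ∈ v.asIdeal), (Literature.NumberTheory.PAdicHodge.fontainePstAdicCompletion v ℓ hv).IsDeRhamFramed (R'.toLocal v)) ∧ (∃ (L : Type) (_ : Field L) (_ : NumberField L) (_ : Algebra F₁ L), ∀ (w : IsDedekindDomain.HeightOneSpectrum (NumberField.RingOfIntegers L)), ((ℓ : ℕ) : NumberField.RingOfIntegers L) ∈ w.asIdeal → (R'.restrictField L).IsUnramifiedAt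 w) ∧ (∃ (mc' : ℕ) (θc' : Literature.NumberTheory.GaloisRepresentations.FramedGaloisRep M (PadicAlgCl ℓ) mc'), ∀ g : Field.absoluteGaloisGroup M, Literature.NumberTheory.GaloisRepresentations.FramedRep.trace (R'.restrictField M) g = Literature.NumberTheory.GaloisRepresentations.FramedRep.trace χ g * Literature.NumberTheory.GaloisRepresentations.FramedRep.trace θ g + Literature.NumberTheory.GaloisRepresentations.FramedRep.trace θc' g)) → (∃ B : Matrix (Fin n) (Fin n) (PadicAlgCl ℓ), B.det ≠ 0 ∧ (Matrix.transpose B = B ∨ Matrix.transpose B = -B) ∧ (∀ g : Field.absoluteGaloisGroup K, ∃ s : PadicAlgCl ℓ, Matrix.transpose ((ρ g : GL (Fin n) (PadicAlgCl ℓ)) : Matrix (Fin n) (Fin n) (PadicAlgCl ℓ)) * B * ((ρ g : GL (Fin n) (PadicAlgCl ℓ)) : Matrix (Fin n) (Fin n) (PadicAlgCl ℓ)) = s • B) ∧ ∀ (φ : K →+* ℝ) (c : Field.absoluteGaloisGroup K), Literature.NumberTheory.GaloisRepresentations.IsComplexConjugation φ c → Matrix.transpose (B * ((ρ c : GL (Fin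 n) (PadicAlgCl ℓ)) : Matrix (Fin n) (Fin n) (PadicAlgCl ℓ))) = B * ((ρ c : GL (Fin n) (PadicAlgCl ℓ)) : Matrix (Fin n) (Fin n) (PadicAlgCl ℓ))) → (∀ (v : IsDedekindDomain.HeightOneSpectrum (NumberField.RingOfIntegers K)) (hv : ((ℓ : ℕ) : NumberField.RingOfIntegers K) ∈ v.asIdeal), ∀ τ : v.adicCompletion K →+* PadicAlgCl ℓ, Continuous τ → ∀ w : ℤ, Multiset.count w (ρ.labelledHodgeTateWeightsAt v (Literature.NumberTheory.PAdicHodge.fontainePstAdicCompletion v ℓ hv).algebra (Literature.NumberTheory.PAdicHodge.fontainePstAdicCompletion v ℓ hv).𝔅 τ) ≤ 2) → ¬ (∀ (v : IsDedekindDomain.HeightOneSpectrum (NumberField.RingOfIntegers K)) (hv : ((ℓ : ℕ) : NumberField.RingOfIntegers K) ∈ v.asIdeal), ∀ τ : v.adicCompletion K →+* PadicAlgCl ℓ, Continuous τ → (ρ.labelledHodgeTateWeightsAt v (Literature.NumberTheory.PAdicHodge.fontainePstAdicCompletion v ℓ hv).algebra (Literature.NumberTheory.PAdicHodge.fontainePstAdicCompletion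 v ℓ hv).𝔅 τ).Nodup) → ∀ (E : Type) [Field E] [NumberField E] [Algebra K E], NumberField.IsCMField E → Module.finrank K E = 2 → (∃ d : ℕ, 0 < d ∧ ∃ x : E, x * x = -(d : E)) → (ρ.restrictField E).toGaloisRep.IsIrreducible → ∀ (𝓡E : Summit.Langlands.ReciprocityData E), Summit.Langlands.IsGeometricFramed 𝓡E (ρ.restrictField E) → ¬ (∃ (χ : Literature.NumberTheory.GaloisRepresentations.FramedGaloisRep E (PadicAlgCl ℓ) 1) (R : Literature.NumberTheory.GaloisRepresentations.FramedGaloisRep E (PadicAlgCl ℓ) n), (∀ g : Field.absoluteGaloisGroup E, Literature.NumberTheory.GaloisRepresentations.FramedRep.trace R g = Literature.NumberTheory.GaloisRepresentations.FramedRep.trace χ g * Literature.NumberTheory.GaloisRepresentations.FramedRep.trace (ρ.restrictField E) g) ∧ ∃ 𝒰 : Literature.NumberTheory.Automorphic.BigHeckeGLn.TameLevel n E ℓ, 𝒰.IsPadicallyAutomorphic R) → ∀ (hcptE : Literature.NumberTheory.Automorphic.isCompact_glFiniteIntegralLevel n E), ∃ π : Literature.NumberTheory.Automorphic.CuspidalAutomorphicRepData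 n E hcptE, π.1.IsLAlgebraic ∧ ∀ᶠ w : IsDedekindDomain.HeightOneSpectrum (NumberField.RingOfIntegers E) in Filter.cofinite, SatakeFrobCompatibleAt ι π.1 (ρ.restrictField E) w

/-- support (rank 9) — DSC, single-layer sign-free descent GIVEN W⁺: K totally real, ρ irreducible geometric; if ρ|_E is weakly automorphic over every CM quadratic layer E ∋ √-d with ρ|_E irreducible (w.r.t. every reciprocity datum of E making it pinned-geometric), then ρ is weakly automorphic over K.  Print-assembled: existence of such a layer (finitely many quadratic self-twists), Arthur–Clozel Ch. 3 Thm 4.2(b) (σ-stable cuspidal Π_E descends), Jacquet–Shalika, W⁺ for the descended π, Chebotarev over E, Clifford (ρ_π ≅ ρ ⊗ ε^a), twist; `Nonempty (ReciprocityData E)` and de Rham heredity under restriction as in stmt 17930. -/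
def LimitLayerDescent : Prop :=
  (∀ (K : Type) [Field K] [NumberField K] (n : ℕ) (hcpt : Literature.NumberTheory.Automorphic.isCompact_glFiniteIntegralLevel n K), 0 < n → ∀ (π : Literature.NumberTheory.Automorphic.CuspidalAutomorphicRepData n K hcpt), π.1.IsLAlgebraic → ∀ (ℓ : ℕ) [Fact ℓ.Prime] (ι : PadicAlgCl ℓ ≃+* ℂ), ∃ ρ : Literature.NumberTheory.GaloisRepresentations.FramedGaloisRep K (PadicAlgCl ℓ) n, ρ.toGaloisRep.IsIrreducible ∧ ∀ᶠ v : IsDedekindDomain.HeightOneSpectrum (NumberField.RingOfIntegers K) in cofinite, SatakeFrobCompatibleAt ι π.1 ρ v) → ∀ (K : Type) [Field K] [NumberField K], NumberField.IsTotallyReal K → ∀ (n : ℕ) (hcpt : Literature.NumberTheory.Automorphic.isCompact_glFiniteIntegralLevel n K), 0 < n → ∀ (ℓ : ℕ) [Fact ℓ.Prime] (ι : PadicAlgCl ℓ ≃+* ℂ) (ρ : Literature.NumberTheory.GaloisRepresentations.FramedGaloisRep K (PadicAlgCl ℓ) n), ρ.toGaloisRep.IsIrreducible → ((∀ᶠ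 v : IsDedekindDomain.HeightOneSpectrum (NumberField.RingOfIntegers K) in Filter.cofinite, ρ.IsUnramifiedAt v) ∧ ∀ (v : IsDedekindDomain.HeightOneSpectrum (NumberField.RingOfIntegers K)) (hv : ((ℓ : ℕ) : NumberField.RingOfIntegers K) ∈ v.asIdeal), (Literature.NumberTheory.PAdicHodge.fontainePstAdicCompletion v ℓ hv).IsDeRhamFramed (ρ.toLocal v)) → (∀ (E : Type) [Field E] [NumberField E] [Algebra K E], NumberField.IsCMField E → Module.finrank K E = 2 → (∃ d : ℕ, 0 < d ∧ ∃ x : E, x * x = -(d : E)) → (ρ.restrictField E).toGaloisRep.IsIrreducible → ∀ (𝓡E : Summit.Langlands.ReciprocityData E), Summit.Langlands.IsGeometricFramed 𝓡E (ρ.restrictField E) → ∀ (hcptE : Literature.NumberTheory.Automorphic.isCompact_glFiniteIntegralLevel n E), ∃ π : Literature.NumberTheory.Automorphic.CuspidalAutomorphicRepData n E hcptE, π.1.IsLAlgebraic ∧ ∀ᶠ w : IsDedekindDomain.HeightOneSpectrum (NumberField.RingOfIntegers E) in Filter.cofinite, SatakeFrobCompatibleAt ι π.1 (ρ.restrictField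 E) w) → ∃ π : Literature.NumberTheory.Automorphic.CuspidalAutomorphicRepData n K hcpt, π.1.IsLAlgebraic ∧ ∀ᶠ v : IsDedekindDomain.HeightOneSpectrum (NumberField.RingOfIntegers K) in Filter.cofinite, SatakeFrobCompatibleAt ι π.1 ρ v

/-- crux (rank 8) — W⁺, SHARED item stmt-Langlands-17415 (verbatim): every cuspidal L-algebraic π of GL_n over a number field has an irreducible ℓ-adic Galois representation with matching Satake parameters at almost all places. -/
def SatakeAvatarExistence : Prop :=
  ∀ (K : Type) [Field K] [NumberField K] (n : ℕ) (hcpt : Literature.NumberTheory.Automorphic.isCompact_glFiniteIntegralLevel n K), 0 < n → ∀ (π : Literature.NumberTheory.Automorphic.CuspidalAutomorphicRepData n K hcpt), π.1.IsLAlgebraic → ∀ (ℓ : ℕ) [Fact ℓ.Prime] (ι : PadicAlgCl ℓ ≃+* ℂ), ∃ ρ : Literature.NumberTheory.GaloisRepresentations.FramedGaloisRep K (PadicAlgCl ℓ) n, ρ.toGaloisRep.IsIrreducible ∧ ∀ᶠ v : IsDedekindDomain.HeightOneSpectrum (NumberField.RingOfIntegers K) in cofinite, SatakeFrobCompatibleAt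 ι π.1 ρ v

/-- support (rank 9) — FRAME, SHARED item stmt-Langlands-27423 (verbatim): the host route TameDarkSplit decides `Langlands` from SDT given its other ten items (`frame_of_host`). -/
def WildDarkAutomorphyFrame : Prop :=
  Summit.Langlands.Langlands.Theses.TameDarkSplit.WildDarkAutomorphy → _root_.Langlands

/-- assembly (rank 1). -/
def Assembly : Prop :=
  DegenerateDarkAutomorphy → VisibleLimitLayerAutomorphy → InvisibleLimitLayerAutomorphy → LimitLayerDescent → SatakeAvatarExistence → WildDarkAutomorphyFrame → _root_.Langlands

/-! ## Node-only statements (the translation layer and the dominating statement; not route items) -/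

/-- node-only — LIMK: the uncapped-limit-type cell of the wild dark box, weak conclusion over K (= LV ∧ LI translated back; `translation_iff`). -/
def CoherentLimitDarkAutomorphy : Prop :=
  ∀ (K : Type) [Field K] [NumberField K], NumberField.IsTotallyReal K → ∀ (n : ℕ) (hcpt : Literature.NumberTheory.Automorphic.isCompact_glFiniteIntegralLevel n K), 0 < n → ∀ (ℓ : ℕ) [Fact ℓ.Prime] (ι : PadicAlgCl ℓ ≃+* ℂ) (ρ : Literature.NumberTheory.GaloisRepresentations.FramedGaloisRep K (PadicAlgCl ℓ) n), ρ.toGaloisRep.IsIrreducible → ((∀ᶠ v : IsDedekindDomain.HeightOneSpectrum (NumberField.RingOfIntegers K) in Filter.cofinite, ρ.IsUnramifiedAt v) ∧ ∀ (v : IsDedekindDomain.HeightOneSpectrum (NumberField.RingOfIntegers K)) (hv : ((ℓ : ℕ) : NumberField.RingOfIntegers K) ∈ v.asIdeal), (Literature.NumberTheory.PAdicHodge.fontainePstAdicCompletion v ℓ hv).IsDeRhamFramed (ρ.toLocal v)) → ¬ (∃ (M E₀ : Type) (_ : Field M) (_ : NumberField M) (_ : Field E₀) (_ : NumberField E₀)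 (_ : Algebra K M) (_ : Algebra M E₀) (_ : Algebra K E₀) (_ : IsScalarTower K M E₀) (_ : IsGalois K E₀), IsSolvable (E₀ ≃ₐ[K] E₀) ∧ ∃ (F₁ E₁ : Type) (_ : Field F₁) (_ : NumberField F₁) (_ : Field E₁) (_ : NumberField E₁) (_ : Algebra F₁ M) (_ : Algebra M E₁) (_ : Algebra F₁ E₁) (_ : IsScalarTower F₁ M E₁) (_ : IsGalois F₁ E₁), NumberField.IsTotallyReal F₁ ∧ IsSolvable (E₁ ≃ₐ[F₁] E₁) ∧ ∃ (m : ℕ) (θ : Literature.NumberTheory.GaloisRepresentations.FramedGaloisRep M (PadicAlgCl ℓ) m), 0 < m ∧ θ.toGaloisRep.IsIrreducible ∧ (∃ (mc : ℕ) (θc : Literature.NumberTheory.GaloisRepresentations.FramedGaloisRep M (PadicAlgCl ℓ) mc), ∀ g : Field.absoluteGaloisGroup M, Literature.NumberTheory.GaloisRepresentations.FramedRep.trace (ρ.restrictField M) g = Literature.NumberTheory.GaloisRepresentations.FramedRep.trace θ g + Literature.NumberTheory.GaloisRepresentations.FramedRep.trace θc g) ∧ ∃ (χ : Literature.NumberTheory.GaloisRepresentations.FramedGaloisRep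 M (PadicAlgCl ℓ) 1) (n' : ℕ) (R' : Literature.NumberTheory.GaloisRepresentations.FramedGaloisRep F₁ (PadicAlgCl ℓ) n'), 0 < n' ∧ R'.toGaloisRep.IsIrreducible ∧ ((∀ᶠ v : IsDedekindDomain.HeightOneSpectrum (NumberField.RingOfIntegers F₁) in Filter.cofinite, R'.IsUnramifiedAt v) ∧ ∀ (v : IsDedekindDomain.HeightOneSpectrum (NumberField.RingOfIntegers F₁)) (hv : ((ℓ : ℕ) : NumberField.RingOfIntegers F₁) ∈ v.asIdeal), (Literature.NumberTheory.PAdicHodge.fontainePstAdicCompletion v ℓ hv).IsDeRhamFramed (R'.toLocal v)) ∧ ((∀ (v : IsDedekindDomain.HeightOneSpectrum (NumberField.RingOfIntegers F₁)) (hv : ((ℓ : ℕ) : NumberField.RingOfIntegers F₁) ∈ v.asIdeal), ∀ τ : v.adicCompletion F₁ →+* PadicAlgCl ℓ, Continuous τ → (R'.labelledHodgeTateWeightsAt v (Literature.NumberTheory.PAdicHodge.fontainePstAdicCompletion v ℓ hv).algebra (Literature.NumberTheory.PAdicHodge.fontainePstAdicCompletion v ℓ hv).𝔅 τ).Nodup)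 ∨ (n' ≤ 4 ∧ (∃ B : Matrix (Fin n') (Fin n') (PadicAlgCl ℓ), B.det ≠ 0 ∧ (Matrix.transpose B = B ∨ Matrix.transpose B = -B) ∧ (∀ g : Field.absoluteGaloisGroup F₁, ∃ s : PadicAlgCl ℓ, Matrix.transpose ((R' g : GL (Fin n') (PadicAlgCl ℓ)) : Matrix (Fin n') (Fin n') (PadicAlgCl ℓ)) * B * ((R' g : GL (Fin n') (PadicAlgCl ℓ)) : Matrix (Fin n') (Fin n') (PadicAlgCl ℓ)) = s • B) ∧ ∀ (φ : F₁ →+* ℝ) (c : Field.absoluteGaloisGroup F₁), Literature.NumberTheory.GaloisRepresentations.IsComplexConjugation φ c → Matrix.transpose (B * ((R' c : GL (Fin n') (PadicAlgCl ℓ)) : Matrix (Fin n') (Fin n') (PadicAlgCl ℓ))) = B * ((R' c : GL (Fin n') (PadicAlgCl ℓ)) : Matrix (Fin n') (Fin n') (PadicAlgCl ℓ))) ∧ (∀ (v : IsDedekindDomain.HeightOneSpectrum (NumberField.RingOfIntegers F₁)) (hv : ((ℓ : ℕ) : NumberField.RingOfIntegers F₁) ∈ v.asIdeal), ∀ τ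 : v.adicCompletion F₁ →+* PadicAlgCl ℓ, Continuous τ → ∀ w : ℤ, Multiset.count w (R'.labelledHodgeTateWeightsAt v (Literature.NumberTheory.PAdicHodge.fontainePstAdicCompletion v ℓ hv).algebra (Literature.NumberTheory.PAdicHodge.fontainePstAdicCompletion v ℓ hv).𝔅 τ) ≤ 2)) ∨ (Set.range fun g : Field.absoluteGaloisGroup F₁ => (R' g : GL (Fin n') (PadicAlgCl ℓ))).Finite) ∧ (∃ (mc' : ℕ) (θc' : Literature.NumberTheory.GaloisRepresentations.FramedGaloisRep M (PadicAlgCl ℓ) mc'), ∀ g : Field.absoluteGaloisGroup M, Literature.NumberTheory.GaloisRepresentations.FramedRep.trace (R'.restrictField M) g = Literature.NumberTheory.GaloisRepresentations.FramedRep.trace χ g * Literature.NumberTheory.GaloisRepresentations.FramedRep.trace θ g + Literature.NumberTheory.GaloisRepresentations.FramedRep.trace θc' g)) → ¬ (∃ (M E₀ : Type) (_ : Field M) (_ : NumberField M) (_ : Field E₀) (_ : NumberField E₀) (_ : Algebra K M) (_ : Algebra M E₀) (_ : Algebra K E₀) (_ : IsScalarTower K M E₀) (_ : IsGalois K E₀),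 IsSolvable (E₀ ≃ₐ[K] E₀) ∧ ∃ (F₁ E₁ : Type) (_ : Field F₁) (_ : NumberField F₁) (_ : Field E₁) (_ : NumberField E₁) (_ : Algebra F₁ M) (_ : Algebra M E₁) (_ : Algebra F₁ E₁) (_ : IsScalarTower F₁ M E₁) (_ : IsGalois F₁ E₁), NumberField.IsTotallyReal F₁ ∧ IsSolvable (E₁ ≃ₐ[F₁] E₁) ∧ ∃ (m : ℕ) (θ : Literature.NumberTheory.GaloisRepresentations.FramedGaloisRep M (PadicAlgCl ℓ) m), 0 < m ∧ θ.toGaloisRep.IsIrreducible ∧ (∃ (mc : ℕ) (θc : Literature.NumberTheory.GaloisRepresentations.FramedGaloisRep M (PadicAlgCl ℓ) mc), ∀ g : Field.absoluteGaloisGroup M, Literature.NumberTheory.GaloisRepresentations.FramedRep.trace (ρ.restrictField M) g = Literature.NumberTheory.GaloisRepresentations.FramedRep.trace θ g + Literature.NumberTheory.GaloisRepresentations.FramedRep.trace θc g) ∧ ∃ (χ : Literature.NumberTheory.GaloisRepresentations.FramedGaloisRep M (PadicAlgCl ℓ) 1) (n' : ℕ) (R' : Literature.NumberTheory.GaloisRepresentations.FramedGaloisRep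 F₁ (PadicAlgCl ℓ) n'), 0 < n' ∧ R'.toGaloisRep.IsIrreducible ∧ ((∀ᶠ v : IsDedekindDomain.HeightOneSpectrum (NumberField.RingOfIntegers F₁) in Filter.cofinite, R'.IsUnramifiedAt v) ∧ ∀ (v : IsDedekindDomain.HeightOneSpectrum (NumberField.RingOfIntegers F₁)) (hv : ((ℓ : ℕ) : NumberField.RingOfIntegers F₁) ∈ v.asIdeal), (Literature.NumberTheory.PAdicHodge.fontainePstAdicCompletion v ℓ hv).IsDeRhamFramed (R'.toLocal v)) ∧ (∃ (L : Type) (_ : Field L) (_ : NumberField L) (_ : Algebra F₁ L), ∀ (w : IsDedekindDomain.HeightOneSpectrum (NumberField.RingOfIntegers L)), ((ℓ : ℕ) : NumberField.RingOfIntegers L) ∈ w.asIdeal → (R'.restrictField L).IsUnramifiedAt w) ∧ (∃ (mc' : ℕ) (θc' : Literature.NumberTheory.GaloisRepresentations.FramedGaloisRep M (PadicAlgCl ℓ) mc'), ∀ g : Field.absoluteGaloisGroup M, Literature.NumberTheory.GaloisRepresentations.FramedRep.trace (R'.restrictField M) g = Literature.NumberTheory.GaloisRepresentations.FramedRep.trace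 χ g * Literature.NumberTheory.GaloisRepresentations.FramedRep.trace θ g + Literature.NumberTheory.GaloisRepresentations.FramedRep.trace θc' g)) → (∃ B : Matrix (Fin n) (Fin n) (PadicAlgCl ℓ), B.det ≠ 0 ∧ (Matrix.transpose B = B ∨ Matrix.transpose B = -B) ∧ (∀ g : Field.absoluteGaloisGroup K, ∃ s : PadicAlgCl ℓ, Matrix.transpose ((ρ g : GL (Fin n) (PadicAlgCl ℓ)) : Matrix (Fin n) (Fin n) (PadicAlgCl ℓ)) * B * ((ρ g : GL (Fin n) (PadicAlgCl ℓ)) : Matrix (Fin n) (Fin n) (PadicAlgCl ℓ)) = s • B) ∧ ∀ (φ : K →+* ℝ) (c : Field.absoluteGaloisGroup K), Literature.NumberTheory.GaloisRepresentations.IsComplexConjugation φ c → Matrix.transpose (B * ((ρ c : GL (Fin n) (PadicAlgCl ℓ)) : Matrix (Fin n) (Fin n) (PadicAlgCl ℓ))) = B * ((ρ c : GL (Fin n) (PadicAlgCl ℓ)) : Matrix (Fin n) (Fin n) (PadicAlgCl ℓ))) → (∀ (v : IsDedekindDomain.HeightOneSpectrum (NumberField.RingOfIntegers K)) (hv : ((ℓ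 : ℕ) : NumberField.RingOfIntegers K) ∈ v.asIdeal), ∀ τ : v.adicCompletion K →+* PadicAlgCl ℓ, Continuous τ → ∀ w : ℤ, Multiset.count w (ρ.labelledHodgeTateWeightsAt v (Literature.NumberTheory.PAdicHodge.fontainePstAdicCompletion v ℓ hv).algebra (Literature.NumberTheory.PAdicHodge.fontainePstAdicCompletion v ℓ hv).𝔅 τ) ≤ 2) → ¬ (∀ (v : IsDedekindDomain.HeightOneSpectrum (NumberField.RingOfIntegers K)) (hv : ((ℓ : ℕ) : NumberField.RingOfIntegers K) ∈ v.asIdeal), ∀ τ : v.adicCompletion K →+* PadicAlgCl ℓ, Continuous τ → (ρ.labelledHodgeTateWeightsAt v (Literature.NumberTheory.PAdicHodge.fontainePstAdicCompletion v ℓ hv).algebra (Literature.NumberTheory.PAdicHodge.fontainePstAdicCompletion v ℓ hv).𝔅 τ).Nodup) → ∃ π : Literature.NumberTheory.Automorphic.CuspidalAutomorphicRepData n K hcpt, π.1.IsLAlgebraic ∧ ∀ᶠ v : IsDedekindDomain.HeightOneSpectrum (NumberField.RingOfIntegers K) in Filter.cofinite, SatakeFrobCompatibleAt ι π.1 ρ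 v

/-- node-only — LIMU = LV ∧ LI without the visibility dial: weak automorphy of ρ|_E over every CM quadratic layer E ∋ √-d with ρ|_E irreducible, for ρ in the wild dark box of uncapped limit type. -/
def LimitLayerAutomorphy : Prop :=
  ∀ (K : Type) [Field K] [NumberField K], NumberField.IsTotallyReal K → ∀ (n : ℕ) (hcpt : Literature.NumberTheory.Automorphic.isCompact_glFiniteIntegralLevel n K), 0 < n → ∀ (ℓ : ℕ) [Fact ℓ.Prime] (ι : PadicAlgCl ℓ ≃+* ℂ) (ρ : Literature.NumberTheory.GaloisRepresentations.FramedGaloisRep K (PadicAlgCl ℓ) n), ρ.toGaloisRep.IsIrreducible → ((∀ᶠ v : IsDedekindDomain.HeightOneSpectrum (NumberField.RingOfIntegers K) in Filter.cofinite, ρ.IsUnramifiedAt v) ∧ ∀ (v : IsDedekindDomain.HeightOneSpectrum (NumberField.RingOfIntegers K)) (hv : ((ℓ : ℕ) : NumberField.RingOfIntegers K) ∈ v.asIdeal), (Literature.NumberTheory.PAdicHodge.fontainePstAdicCompletion v ℓ hv).IsDeRhamFramed (ρ.toLocal v)) → ¬ (∃ (M E₀ : Type) (_ : Field M) (_ :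 NumberField M) (_ : Field E₀) (_ : NumberField E₀) (_ : Algebra K M) (_ : Algebra M E₀) (_ : Algebra K E₀) (_ : IsScalarTower K M E₀) (_ : IsGalois K E₀), IsSolvable (E₀ ≃ₐ[K] E₀) ∧ ∃ (F₁ E₁ : Type) (_ : Field F₁) (_ : NumberField F₁) (_ : Field E₁) (_ : NumberField E₁) (_ : Algebra F₁ M) (_ : Algebra M E₁) (_ : Algebra F₁ E₁) (_ : IsScalarTower F₁ M E₁) (_ : IsGalois F₁ E₁), NumberField.IsTotallyReal F₁ ∧ IsSolvable (E₁ ≃ₐ[F₁] E₁) ∧ ∃ (m : ℕ) (θ : Literature.NumberTheory.GaloisRepresentations.FramedGaloisRep M (PadicAlgCl ℓ) m), 0 < m ∧ θ.toGaloisRep.IsIrreducible ∧ (∃ (mc : ℕ) (θc : Literature.NumberTheory.GaloisRepresentations.FramedGaloisRep M (PadicAlgCl ℓ) mc), ∀ g : Field.absoluteGaloisGroup M, Literature.NumberTheory.GaloisRepresentations.FramedRep.trace (ρ.restrictField M) g = Literature.NumberTheory.GaloisRepresentations.FramedRep.trace θ g + Literature.NumberTheory.GaloisRepresentations.FramedRep.trace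 θc g) ∧ ∃ (χ : Literature.NumberTheory.GaloisRepresentations.FramedGaloisRep M (PadicAlgCl ℓ) 1) (n' : ℕ) (R' : Literature.NumberTheory.GaloisRepresentations.FramedGaloisRep F₁ (PadicAlgCl ℓ) n'), 0 < n' ∧ R'.toGaloisRep.IsIrreducible ∧ ((∀ᶠ v : IsDedekindDomain.HeightOneSpectrum (NumberField.RingOfIntegers F₁) in Filter.cofinite, R'.IsUnramifiedAt v) ∧ ∀ (v : IsDedekindDomain.HeightOneSpectrum (NumberField.RingOfIntegers F₁)) (hv : ((ℓ : ℕ) : NumberField.RingOfIntegers F₁) ∈ v.asIdeal), (Literature.NumberTheory.PAdicHodge.fontainePstAdicCompletion v ℓ hv).IsDeRhamFramed (R'.toLocal v)) ∧ ((∀ (v : IsDedekindDomain.HeightOneSpectrum (NumberField.RingOfIntegers F₁)) (hv : ((ℓ : ℕ) : NumberField.RingOfIntegers F₁) ∈ v.asIdeal), ∀ τ : v.adicCompletion F₁ →+* PadicAlgCl ℓ, Continuous τ → (R'.labelledHodgeTateWeightsAt v (Literature.NumberTheory.PAdicHodge.fontainePstAdicCompletion v ℓ hv).algebra (Literature.NumberTheory.PAdicHodge.fontainePstAdicCompletion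 v ℓ hv).𝔅 τ).Nodup) ∨ (n' ≤ 4 ∧ (∃ B : Matrix (Fin n') (Fin n') (PadicAlgCl ℓ), B.det ≠ 0 ∧ (Matrix.transpose B = B ∨ Matrix.transpose B = -B) ∧ (∀ g : Field.absoluteGaloisGroup F₁, ∃ s : PadicAlgCl ℓ, Matrix.transpose ((R' g : GL (Fin n') (PadicAlgCl ℓ)) : Matrix (Fin n') (Fin n') (PadicAlgCl ℓ)) * B * ((R' g : GL (Fin n') (PadicAlgCl ℓ)) : Matrix (Fin n') (Fin n') (PadicAlgCl ℓ)) = s • B) ∧ ∀ (φ : F₁ →+* ℝ) (c : Field.absoluteGaloisGroup F₁), Literature.NumberTheory.GaloisRepresentations.IsComplexConjugation φ c → Matrix.transpose (B * ((R' c : GL (Fin n') (PadicAlgCl ℓ)) : Matrix (Fin n') (Fin n') (PadicAlgCl ℓ))) = B * ((R' c : GL (Fin n') (PadicAlgCl ℓ)) : Matrix (Fin n') (Fin n') (PadicAlgCl ℓ))) ∧ (∀ (v : IsDedekindDomain.HeightOneSpectrum (NumberField.RingOfIntegers F₁)) (hv : ((ℓ : ℕ) : NumberField.RingOfIntegers F₁)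 ∈ v.asIdeal), ∀ τ : v.adicCompletion F₁ →+* PadicAlgCl ℓ, Continuous τ → ∀ w : ℤ, Multiset.count w (R'.labelledHodgeTateWeightsAt v (Literature.NumberTheory.PAdicHodge.fontainePstAdicCompletion v ℓ hv).algebra (Literature.NumberTheory.PAdicHodge.fontainePstAdicCompletion v ℓ hv).𝔅 τ) ≤ 2)) ∨ (Set.range fun g : Field.absoluteGaloisGroup F₁ => (R' g : GL (Fin n') (PadicAlgCl ℓ))).Finite) ∧ (∃ (mc' : ℕ) (θc' : Literature.NumberTheory.GaloisRepresentations.FramedGaloisRep M (PadicAlgCl ℓ) mc'), ∀ g : Field.absoluteGaloisGroup M, Literature.NumberTheory.GaloisRepresentations.FramedRep.trace (R'.restrictField M) g = Literature.NumberTheory.GaloisRepresentations.FramedRep.trace χ g * Literature.NumberTheory.GaloisRepresentations.FramedRep.trace θ g + Literature.NumberTheory.GaloisRepresentations.FramedRep.trace θc' g)) → ¬ (∃ (M E₀ : Type) (_ : Field M) (_ : NumberField M) (_ : Field E₀) (_ : NumberField E₀) (_ : Algebra K M) (_ : Algebra M E₀) (_ : Algebra K E₀) (_ : IsScalarTower K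 M E₀) (_ : IsGalois K E₀), IsSolvable (E₀ ≃ₐ[K] E₀) ∧ ∃ (F₁ E₁ : Type) (_ : Field F₁) (_ : NumberField F₁) (_ : Field E₁) (_ : NumberField E₁) (_ : Algebra F₁ M) (_ : Algebra M E₁) (_ : Algebra F₁ E₁) (_ : IsScalarTower F₁ M E₁) (_ : IsGalois F₁ E₁), NumberField.IsTotallyReal F₁ ∧ IsSolvable (E₁ ≃ₐ[F₁] E₁) ∧ ∃ (m : ℕ) (θ : Literature.NumberTheory.GaloisRepresentations.FramedGaloisRep M (PadicAlgCl ℓ) m), 0 < m ∧ θ.toGaloisRep.IsIrreducible ∧ (∃ (mc : ℕ) (θc : Literature.NumberTheory.GaloisRepresentations.FramedGaloisRep M (PadicAlgCl ℓ) mc), ∀ g : Field.absoluteGaloisGroup M, Literature.NumberTheory.GaloisRepresentations.FramedRep.trace (ρ.restrictField M) g = Literature.NumberTheory.GaloisRepresentations.FramedRep.trace θ g + Literature.NumberTheory.GaloisRepresentations.FramedRep.trace θc g) ∧ ∃ (χ : Literature.NumberTheory.GaloisRepresentations.FramedGaloisRep M (PadicAlgCl ℓ) 1) (n' : ℕ)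 (R' : Literature.NumberTheory.GaloisRepresentations.FramedGaloisRep F₁ (PadicAlgCl ℓ) n'), 0 < n' ∧ R'.toGaloisRep.IsIrreducible ∧ ((∀ᶠ v : IsDedekindDomain.HeightOneSpectrum (NumberField.RingOfIntegers F₁) in Filter.cofinite, R'.IsUnramifiedAt v) ∧ ∀ (v : IsDedekindDomain.HeightOneSpectrum (NumberField.RingOfIntegers F₁)) (hv : ((ℓ : ℕ) : NumberField.RingOfIntegers F₁) ∈ v.asIdeal), (Literature.NumberTheory.PAdicHodge.fontainePstAdicCompletion v ℓ hv).IsDeRhamFramed (R'.toLocal v)) ∧ (∃ (L : Type) (_ : Field L) (_ : NumberField L) (_ : Algebra F₁ L), ∀ (w : IsDedekindDomain.HeightOneSpectrum (NumberField.RingOfIntegers L)), ((ℓ : ℕ) : NumberField.RingOfIntegers L) ∈ w.asIdeal → (R'.restrictField L).IsUnramifiedAt w) ∧ (∃ (mc' : ℕ) (θc' : Literature.NumberTheory.GaloisRepresentations.FramedGaloisRep M (PadicAlgCl ℓ) mc'), ∀ g : Field.absoluteGaloisGroup M, Literature.NumberTheory.GaloisRepresentations.FramedRep.trace (R'.restrictField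 M) g = Literature.NumberTheory.GaloisRepresentations.FramedRep.trace χ g * Literature.NumberTheory.GaloisRepresentations.FramedRep.trace θ g + Literature.NumberTheory.GaloisRepresentations.FramedRep.trace θc' g)) → (∃ B : Matrix (Fin n) (Fin n) (PadicAlgCl ℓ), B.det ≠ 0 ∧ (Matrix.transpose B = B ∨ Matrix.transpose B = -B) ∧ (∀ g : Field.absoluteGaloisGroup K, ∃ s : PadicAlgCl ℓ, Matrix.transpose ((ρ g : GL (Fin n) (PadicAlgCl ℓ)) : Matrix (Fin n) (Fin n) (PadicAlgCl ℓ)) * B * ((ρ g : GL (Fin n) (PadicAlgCl ℓ)) : Matrix (Fin n) (Fin n) (PadicAlgCl ℓ)) = s • B) ∧ ∀ (φ : K →+* ℝ) (c : Field.absoluteGaloisGroup K), Literature.NumberTheory.GaloisRepresentations.IsComplexConjugation φ c → Matrix.transpose (B * ((ρ c : GL (Fin n) (PadicAlgCl ℓ)) : Matrix (Fin n) (Fin n) (PadicAlgCl ℓ))) = B * ((ρ c : GL (Fin n) (PadicAlgCl ℓ)) : Matrix (Fin n) (Fin n) (PadicAlgCl ℓ))) → (∀ (v : IsDedekindDomain.HeightOneSpectrum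 (NumberField.RingOfIntegers K)) (hv : ((ℓ : ℕ) : NumberField.RingOfIntegers K) ∈ v.asIdeal), ∀ τ : v.adicCompletion K →+* PadicAlgCl ℓ, Continuous τ → ∀ w : ℤ, Multiset.count w (ρ.labelledHodgeTateWeightsAt v (Literature.NumberTheory.PAdicHodge.fontainePstAdicCompletion v ℓ hv).algebra (Literature.NumberTheory.PAdicHodge.fontainePstAdicCompletion v ℓ hv).𝔅 τ) ≤ 2) → ¬ (∀ (v : IsDedekindDomain.HeightOneSpectrum (NumberField.RingOfIntegers K)) (hv : ((ℓ : ℕ) : NumberField.RingOfIntegers K) ∈ v.asIdeal), ∀ τ : v.adicCompletion K →+* PadicAlgCl ℓ, Continuous τ → (ρ.labelledHodgeTateWeightsAt v (Literature.NumberTheory.PAdicHodge.fontainePstAdicCompletion v ℓ hv).algebra (Literature.NumberTheory.PAdicHodge.fontainePstAdicCompletion v ℓ hv).𝔅 τ).Nodup) → ∀ (E : Type) [Field E] [NumberField E] [Algebra K E], NumberField.IsCMField E → Module.finrank K E = 2 → (∃ d : ℕ, 0 < d ∧ ∃ x : E, x * x = -(d : E)) → (ρ.restrictField E).toGaloisRep.IsIrreducible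 → ∀ (𝓡E : Summit.Langlands.ReciprocityData E), Summit.Langlands.IsGeometricFramed 𝓡E (ρ.restrictField E) → ∀ (hcptE : Literature.NumberTheory.Automorphic.isCompact_glFiniteIntegralLevel n E), ∃ π : Literature.NumberTheory.Automorphic.CuspidalAutomorphicRepData n E hcptE, π.1.IsLAlgebraic ∧ ∀ᶠ w : IsDedekindDomain.HeightOneSpectrum (NumberField.RingOfIntegers E) in Filter.cofinite, SatakeFrobCompatibleAt ι π.1 (ρ.restrictField E) w

/-- node-only print fact — (BC): weak automorphy of an irreducible geometric ρ over totally real K base-changes to weak automorphy of ρ|_E over every CM quadratic layer E on which ρ|_E stays irreducible [Arthur–Clozel 1989, Ch. 3 Thm 4.2 (quadratic base change exists; BC(π) cuspidal iff π ≄ π ⊗ ε, which holds since ρ|_E is irreducible, via Jacquet–Shalika) and Thm 5.1; Satake compatibility of BC at split/inert unramified places, AC Ch. 1 §6]. -/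
def WeakQuadraticBaseChange : Prop :=
  ∀ (K : Type) [Field K] [NumberField K], NumberField.IsTotallyReal K → ∀ (n : ℕ) (hcpt : Literature.NumberTheory.Automorphic.isCompact_glFiniteIntegralLevel n K), 0 < n → ∀ (ℓ : ℕ) [Fact ℓ.Prime] (ι : PadicAlgCl ℓ ≃+* ℂ) (ρ : Literature.NumberTheory.GaloisRepresentations.FramedGaloisRep K (PadicAlgCl ℓ) n), ρ.toGaloisRep.IsIrreducible → ((∀ᶠ v : IsDedekindDomain.HeightOneSpectrum (NumberField.RingOfIntegers K) in Filter.cofinite, ρ.IsUnramifiedAt v) ∧ ∀ (v : IsDedekindDomain.HeightOneSpectrum (NumberField.RingOfIntegers K)) (hv : ((ℓ : ℕ) : NumberField.RingOfIntegers K) ∈ v.asIdeal), (Literature.NumberTheory.PAdicHodge.fontainePstAdicCompletion v ℓ hv).IsDeRhamFramed (ρ.toLocal v)) → (∃ π : Literature.NumberTheory.Automorphic.CuspidalAutomorphicRepData n K hcpt, π.1.IsLAlgebraic ∧ ∀ᶠ v : IsDedekindDomain.HeightOneSpectrum (NumberField.RingOfIntegers K) in Filter.cofinite, SatakeFrobCompatibleAt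 ι π.1 ρ v) → ∀ (E : Type) [Field E] [NumberField E] [Algebra K E], NumberField.IsCMField E → Module.finrank K E = 2 → (∃ d : ℕ, 0 < d ∧ ∃ x : E, x * x = -(d : E)) → (ρ.restrictField E).toGaloisRep.IsIrreducible → ∀ (𝓡E : Summit.Langlands.ReciprocityData E), Summit.Langlands.IsGeometricFramed 𝓡E (ρ.restrictField E) → ∀ (hcptE : Literature.NumberTheory.Automorphic.isCompact_glFiniteIntegralLevel n E), ∃ π : Literature.NumberTheory.Automorphic.CuspidalAutomorphicRepData n E hcptE, π.1.IsLAlgebraic ∧ ∀ᶠ w : IsDedekindDomain.HeightOneSpectrum (NumberField.RingOfIntegers E) in Filter.cofinite, SatakeFrobCompatibleAt ι π.1 (ρ.restrictField E) w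

/-- node-only — HL∞: the host crux HL_TR `TameDarkSplit.HolomorphicLimitAutomorphy` (32003) with the rank cap `n ≤ 4` removed.  Dominates both HL_TR and LIMK (`hl_of_uncappedHL`, `limK_of_uncappedHL`). -/
def UncappedHolomorphicLimitAutomorphy : Prop :=
  ∀ (K : Type) [Field K] [NumberField K], NumberField.IsTotallyReal K → ∀ (n : ℕ) (hcpt : Literature.NumberTheory.Automorphic.isCompact_glFiniteIntegralLevel n K), 0 < n → ∀ (ℓ : ℕ) [Fact ℓ.Prime] (ι : PadicAlgCl ℓ ≃+* ℂ) (ρ : Literature.NumberTheory.GaloisRepresentations.FramedGaloisRep K (PadicAlgCl ℓ) n), ρ.toGaloisRep.IsIrreducible → ((∀ᶠ v : IsDedekindDomain.HeightOneSpectrum (NumberField.RingOfIntegers K) in Filter.cofinite, ρ.IsUnramifiedAt v) ∧ ∀ (v : IsDedekindDomain.HeightOneSpectrum (NumberField.RingOfIntegers K)) (hv : ((ℓ : ℕ) : NumberField.RingOfIntegers K) ∈ v.asIdeal), (Literature.NumberTheory.PAdicHodge.fontainePstAdicCompletion v ℓ hv).IsDeRhamFramed (ρ.toLocal v)) → (∃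 B : Matrix (Fin n) (Fin n) (PadicAlgCl ℓ), B.det ≠ 0 ∧ (Matrix.transpose B = B ∨ Matrix.transpose B = -B) ∧ (∀ g : Field.absoluteGaloisGroup K, ∃ s : PadicAlgCl ℓ, Matrix.transpose ((ρ g : GL (Fin n) (PadicAlgCl ℓ)) : Matrix (Fin n) (Fin n) (PadicAlgCl ℓ)) * B * ((ρ g : GL (Fin n) (PadicAlgCl ℓ)) : Matrix (Fin n) (Fin n) (PadicAlgCl ℓ)) = s • B) ∧ ∀ (φ : K →+* ℝ) (c : Field.absoluteGaloisGroup K), Literature.NumberTheory.GaloisRepresentations.IsComplexConjugation φ c → Matrix.transpose (B * ((ρ c : GL (Fin n) (PadicAlgCl ℓ)) : Matrix (Fin n) (Fin n) (PadicAlgCl ℓ))) = B * ((ρ c : GL (Fin n) (PadicAlgCl ℓ)) : Matrix (Fin n) (Fin n) (PadicAlgCl ℓ))) → (∀ (v : IsDedekindDomain.HeightOneSpectrum (NumberField.RingOfIntegers K)) (hv : ((ℓ : ℕ) : NumberField.RingOfIntegers K) ∈ v.asIdeal), ∀ τ : v.adicCompletion K →+* PadicAlgCl ℓ, Continuous τ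 → ∀ w : ℤ, Multiset.count w (ρ.labelledHodgeTateWeightsAt v (Literature.NumberTheory.PAdicHodge.fontainePstAdicCompletion v ℓ hv).algebra (Literature.NumberTheory.PAdicHodge.fontainePstAdicCompletion v ℓ hv).𝔅 τ) ≤ 2) → ¬ (∀ (v : IsDedekindDomain.HeightOneSpectrum (NumberField.RingOfIntegers K)) (hv : ((ℓ : ℕ) : NumberField.RingOfIntegers K) ∈ v.asIdeal), ∀ τ : v.adicCompletion K →+* PadicAlgCl ℓ, Continuous τ → (ρ.labelledHodgeTateWeightsAt v (Literature.NumberTheory.PAdicHodge.fontainePstAdicCompletion v ℓ hv).algebra (Literature.NumberTheory.PAdicHodge.fontainePstAdicCompletion v ℓ hv).𝔅 τ).Nodup) → ∃ π : Literature.NumberTheory.Automorphic.CuspidalAutomorphicRepData n K hcpt, π.1.IsLAlgebraic ∧ ∀ᶠ v : IsDedekindDomain.HeightOneSpectrum (NumberField.RingOfIntegers K) in Filter.cofinite, SatakeFrobCompatibleAt ι π.1 ρ v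

/-! ## Kernels (all sorry-free; `#print axioms` at the end of the file) -/

section Kernels

/-- SHARED-ITEM IDENTITY: W⁺ here is syntactically the host's item 17415. -/
example : SatakeAvatarExistence ↔ Summit.Langlands.Langlands.Theses.TameDarkSplit.SatakeAvatarExistence := Iff.rfl

/-- WEAKER: LIMK is the restriction of SDT to a sub-box. -/
theorem limK_of_wildDark (h : Summit.Langlands.Langlands.Theses.TameDarkSplit.WildDarkAutomorphy) :
    CoherentLimitDarkAutomorphy := by
  intro K _ _ hK n hcpt hn ℓ _ ι ρ hirr hgeom hW hT _ _ _
  exact h K hK n hcpt hn ℓ ι ρ hirr hgeom hW hT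

/-- WEAKER: DEG is the restriction of SDT to the complementary sub-box. -/
theorem deg_of_wildDark (h : Summit.Langlands.Langlands.Theses.TameDarkSplit.WildDarkAutomorphy) :
    DegenerateDarkAutomorphy := by
  intro K _ _ hK n hcpt hn ℓ _ ι ρ hirr hgeom hW hT _
  exact h K hK n hcpt hn ℓ ι ρ hirr hgeom hW hT

/-- EXACTNESS of the K-side split: SDT ⟺ LIMK ∧ DEG (excluded middle on LIM(ρ); the cells are disjoint). -/
theorem wildDark_iff_cells :
    Summit.Langlands.Langlands.Theses.TameDarkSplit.WildDarkAutomorphy ↔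
      (CoherentLimitDarkAutomorphy ∧ DegenerateDarkAutomorphy) := by
  refine ⟨fun h => ⟨limK_of_wildDark h, deg_of_wildDark h⟩, fun h => ?_⟩
  intro K _ _ hK n hcpt hn ℓ _ ι ρ hirr hgeom hW hT
  refine (Classical.em _).elim (fun hlim => ?_) (fun hnlim => h.2 K hK n hcpt hn ℓ ι ρ hirr hgeom hW hT hnlim)
  exact h.1 K hK n hcpt hn ℓ ι ρ hirr hgeom hW hT hlim.1 hlim.2.1 hlim.2.2

/-- The two layer cells. -/
theorem lv_of_limitLayer (h : LimitLayerAutomorphy) : VisibleLimitLayerAutomorphy := by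
  intro K _ _ hK n hcpt hn ℓ _ ι ρ hirr hgeom hW hT hB hM hnreg E _ _ _ hCM hdeg hsqrt hirrE 𝓡E hgeomE _ hcptE
  exact h K hK n hcpt hn ℓ ι ρ hirr hgeom hW hT hB hM hnreg E hCM hdeg hsqrt hirrE 𝓡E hgeomE hcptE

/-- LIMU ⟹ LI (the invisible half of the layer statement). -/
theorem li_of_limitLayer (h : LimitLayerAutomorphy) : InvisibleLimitLayerAutomorphy := by
  intro K _ _ hK n hcpt hn ℓ _ ι ρ hirr hgeom hW hT hB hM hnreg E _ _ _ hCM hdeg hsqrt hirrE 𝓡E hgeomE _ hcptE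
  exact h K hK n hcpt hn ℓ ι ρ hirr hgeom hW hT hB hM hnreg E hCM hdeg hsqrt hirrE 𝓡E hgeomE hcptE

/-- EXACTNESS of the split beneath the translation: LIMU ⟺ LV ∧ LI (excluded middle on 𝕋(E)-visibility per (ρ, E)). -/
theorem limitLayer_iff_cells : LimitLayerAutomorphy ↔ (VisibleLimitLayerAutomorphy ∧ InvisibleLimitLayerAutomorphy) := by
  refine ⟨fun h => ⟨lv_of_limitLayer h, li_of_limitLayer h⟩, fun h => ?_⟩
  intro K _ _ hK n hcpt hn ℓ _ ι ρ hirr hgeom hW hT hB hM hnreg E _ _ _ hCM hdeg hsqrt hirrE 𝓡E hgeomE hcptE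
  exact (Classical.em _).elim
    (fun hvis => h.1 K hK n hcpt hn ℓ ι ρ hirr hgeom hW hT hB hM hnreg E hCM hdeg hsqrt hirrE 𝓡E hgeomE hvis hcptE)
    (fun hnvis => h.2 K hK n hcpt hn ℓ ι ρ hirr hgeom hW hT hB hM hnreg E hCM hdeg hsqrt hirrE 𝓡E hgeomE hnvis hcptE)

/-- TRANSLATION, load-bearing direction: layer automorphy descends to the coherent cell along DSC (given W⁺). -/
theorem layers_to_limK (hW : SatakeAvatarExistence) (hD : LimitLayerDescent) (h : LimitLayerAutomorphy) :
    CoherentLimitDarkAutomorphy := by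
  intro K _ _ hK n hcpt hn ℓ _ ι ρ hirr hgeom hW' hT hB hM hnreg
  exact hD hW K hK n hcpt hn ℓ ι ρ hirr hgeom
    (fun E _ _ _ hCM hdeg hsqrt hirrE 𝓡E hgeomE hcptE =>
      h K hK n hcpt hn ℓ ι ρ hirr hgeom hW' hT hB hM hnreg E hCM hdeg hsqrt hirrE 𝓡E hgeomE hcptE)

/-- TRANSLATION, converse direction: weak automorphy on the coherent cell base-changes to the layers along (BC). -/
theorem limK_to_layers (hBC : WeakQuadraticBaseChange) (h : CoherentLimitDarkAutomorphy) : LimitLayerAutomorphy := by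
  intro K _ _ hK n hcpt hn ℓ _ ι ρ hirr hgeom hW hT hB hM hnreg E _ _ _ hCM hdeg hsqrt hirrE 𝓡E hgeomE hcptE
  exact hBC K hK n hcpt hn ℓ ι ρ hirr hgeom (h K hK n hcpt hn ℓ ι ρ hirr hgeom hW hT hB hM hnreg)
    E hCM hdeg hsqrt hirrE 𝓡E hgeomE hcptE

/-- THE CERTIFIED TRANSLATION (lens 3's single EQUIV): modulo weak quadratic base change (BC, print, node-only) and the
single-layer descent (DSC, support item) given W⁺ (shared item),   LIMK  ⟺  LIMU. -/
theorem translation_iff (hW : SatakeAvatarExistence) (hBC : WeakQuadraticBaseChange) (hD : LimitLayerDescent) :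
    CoherentLimitDarkAutomorphy ↔ LimitLayerAutomorphy :=
  ⟨limK_to_layers hBC, layers_to_limK hW hD⟩

/-- NODE KERNEL: the five non-frame pieces give SDT. -/
theorem wildDark_of_pieces (hDEG : DegenerateDarkAutomorphy) (hLV : VisibleLimitLayerAutomorphy)
    (hLI : InvisibleLimitLayerAutomorphy) (hD : LimitLayerDescent) (hW : SatakeAvatarExistence) :
    Summit.Langlands.Langlands.Theses.TameDarkSplit.WildDarkAutomorphy :=
  wildDark_iff_cells.2 ⟨layers_to_limK hW hD (limitLayer_iff_cells.2 ⟨hLV, hLI⟩), hDEG⟩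

/-- DOMINATION: the uncapped host statement HL∞ gives the host crux HL_TR … -/
theorem hl_of_uncappedHL (h : UncappedHolomorphicLimitAutomorphy) :
    Summit.Langlands.Langlands.Theses.TameDarkSplit.HolomorphicLimitAutomorphy := by
  intro K _ _ hK n hcpt hn ℓ _ ι ρ hirr hgeom _ hB hM hnreg
  exact h K hK n hcpt hn ℓ ι ρ hirr hgeom hB hM hnreg

/-- … and the coherent cell LIMK (so HL∞ closes LV and LI through `limK_to_layers`). -/
theorem limK_of_uncappedHL (h : UncappedHolomorphicLimitAutomorphy) : CoherentLimitDarkAutomorphy := by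
  intro K _ _ hK n hcpt hn ℓ _ ι ρ hirr hgeom _ _ hB hM hnreg
  exact h K hK n hcpt hn ℓ ι ρ hirr hgeom hB hM hnreg

/-- FRAME = the host's deciding theorem with hSDT abstracted. -/
theorem frame_of_host
    (hAD : Summit.Langlands.Langlands.Theses.TameDarkSplit.HigherRankArtinAutomorphy)
    (hTSS : Summit.Langlands.Langlands.Theses.TameDarkSplit.TameNonsolvableDarkAutomorphy)
    (hTSA : Summit.Langlands.Langlands.Theses.TameDarkSplit.TameSolvableImageFinite)
    (hFP : Summit.Langlands.Langlands.Theses.TameDarkSplit.TwistedArtinFinitePoles)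
    (hBOOT : Summit.Langlands.Langlands.Theses.TameDarkSplit.UnramifiedPoleBootstrap)
    (hJLBK : Summit.Langlands.Langlands.Theses.TameDarkSplit.ArtinConverseDictionary)
    (hHL : Summit.Langlands.Langlands.Theses.TameDarkSplit.HolomorphicLimitAutomorphy)
    (hMT : Summit.Langlands.Langlands.Theses.TameDarkSplit.RegularizingMoveTransport)
    (hW : Summit.Langlands.Langlands.Theses.TameDarkSplit.SatakeAvatarExistence)
    (hFrame : Summit.Langlands.Langlands.Theses.TameDarkSplit.NonRegularizableFrame) :
    WildDarkAutomorphyFrame :=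
  fun hSDT => Summit.Langlands.Langlands.Theses.TameDarkSplit.closes hAD hTSS hSDT hTSA hFP hBOOT hJLBK hHL hMT hW hFrame

-- `wildDark_of_langlands` (S ⟹ SDT) is ALREADY LANDED in `Theorems/TameDarkSplitCMLayerPatching.lean` (census twin of lens-3-g12, p779531);
-- it is reused below by its full name instead of being restated (gate `dedup.landed`, p782460).

/-- S ⟹ LIMK (necessity). -/
theorem limK_of_langlands (hL : _root_.Langlands) : CoherentLimitDarkAutomorphy :=
  limK_of_wildDark (Summit.Langlands.Langlands.Theorems.TameDarkSplitCMLayerPatching.wildDark_of_langlands hL)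

/-- S ⟹ DEG (necessity of the declared residual). -/
theorem deg_of_langlands (hL : _root_.Langlands) : DegenerateDarkAutomorphy :=
  deg_of_wildDark (Summit.Langlands.Langlands.Theorems.TameDarkSplitCMLayerPatching.wildDark_of_langlands hL)

/-- S ⟹ LIMU (clause (B) of the summit over the layer field E). -/
theorem limitLayer_of_langlands (hL : _root_.Langlands) : LimitLayerAutomorphy := by
  intro K _ _ hK n hcpt hn ℓ _ ι ρ hirr hgeom hW hT _ _ _ E _ _ _ hCM hdeg hsqrt hirrE 𝓡E hgeomE hcptE
  obtain ⟨_, h⟩ := hL E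
  obtain ⟨π, hLalg, hcorr⟩ := (h 𝓡E n hn hcptE).2 ℓ ι (ρ.restrictField E) hirrE hgeomE
  exact ⟨π, hLalg, hcorr.1⟩

/-- S ⟹ LV (necessity). -/
theorem lv_of_langlands (hL : _root_.Langlands) : VisibleLimitLayerAutomorphy :=
  lv_of_limitLayer (limitLayer_of_langlands hL)

/-- S ⟹ LI (necessity). -/
theorem li_of_langlands (hL : _root_.Langlands) : InvisibleLimitLayerAutomorphy :=
  li_of_limitLayer (limitLayer_of_langlands hL)

/-- S ⟹ DSC (necessity of the descent support). -/
theorem dsc_of_langlands (hL : _root_.Langlands) : LimitLayerDescent := by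
  intro _ K _ _ hK n hcpt hn ℓ _ ι ρ hirr hgeom _
  obtain ⟨⟨𝓡⟩, h⟩ := hL K
  obtain ⟨π, hLalg, hcorr⟩ := (h 𝓡 n hn hcpt).2 ℓ ι ρ hirr ⟨hgeom.1, fun v hv => hgeom.2 v hv⟩
  exact ⟨π, hLalg, hcorr.1⟩

/-- S ⟹ W⁺ (clause (A): an irreducible avatar with a.e. Satake compatibility). -/
theorem w_of_langlands (hL : _root_.Langlands) : SatakeAvatarExistence := by
  intro K _ _ n hcpt hn π hLalg ℓ _ ι
  obtain ⟨⟨𝓡⟩, h⟩ := hL K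
  obtain ⟨ρ, hirr, -, hcorr, -⟩ := (h 𝓡 n hn hcpt).1 π hLalg ℓ ι
  exact ⟨ρ, hirr, hcorr.1⟩

/-- FRAME is S-implied trivially (its conclusion IS the summit). -/
theorem frame_of_langlands (hL : _root_.Langlands) : WildDarkAutomorphyFrame := fun _ => hL

/-- S ⟹ BC (the node-only weak quadratic base change predicate is S-implied). -/
theorem bc_of_langlands (hL : _root_.Langlands) : WeakQuadraticBaseChange := by
  intro K _ _ hK n hcpt hn ℓ _ ι ρ hirr hgeom _ E _ _ _ hCM hdeg hsqrt hirrE 𝓡E hgeomE hcptE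
  obtain ⟨_, h⟩ := hL E
  obtain ⟨π, hLalg, hcorr⟩ := (h 𝓡E n hn hcptE).2 ℓ ι (ρ.restrictField E) hirrE hgeomE
  exact ⟨π, hLalg, hcorr.1⟩

/-- S ⟹ HL∞ (the uncapped holomorphic-limit statement is S-implied). -/
theorem uncappedHL_of_langlands (hL : _root_.Langlands) : UncappedHolomorphicLimitAutomorphy := by
  intro K _ _ hK n hcpt hn ℓ _ ι ρ hirr hgeom _ _ _
  obtain ⟨⟨𝓡⟩, h⟩ := hL K
  obtain ⟨π, hLalg, hcorr⟩ := (h 𝓡 n hn hcpt).2 ℓ ι ρ hirr ⟨hgeom.1, fun v hv => hgeom.2 v hv⟩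
  exact ⟨π, hLalg, hcorr.1⟩

/-- NECESSITY CERTIFICATE (crit-1 standard): every route item is implied by `Langlands`. -/
theorem pieces_of_langlands (hL : _root_.Langlands) :
    DegenerateDarkAutomorphy ∧ VisibleLimitLayerAutomorphy ∧ InvisibleLimitLayerAutomorphy ∧ LimitLayerDescent ∧
      SatakeAvatarExistence ∧ WildDarkAutomorphyFrame :=
  ⟨deg_of_langlands hL, lv_of_langlands hL, li_of_langlands hL, dsc_of_langlands hL, w_of_langlands hL,
    frame_of_langlands hL⟩

/-- DECIDING THEOREM of the child route CoherentChamberSplit (byte-identical to the kit's `childroute.glue.lean` modulo the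
inlining of `wildDark_of_pieces`). -/
theorem closes (hDEG : DegenerateDarkAutomorphy) (hLV : VisibleLimitLayerAutomorphy) (hLI : InvisibleLimitLayerAutomorphy)
    (hD : LimitLayerDescent) (hW : SatakeAvatarExistence) (hF : WildDarkAutomorphyFrame) : _root_.Langlands :=
  hF (wildDark_of_pieces hDEG hLV hLI hD hW)

/-- The Assembly item holds: the pieces compose to the summit through `closes`. -/
theorem assembly_holds : Assembly := fun hDEG hLV hLI hD hW hF => closes hDEG hLV hLI hD hW hF

end Kernels

end Summit.Langlands.Langlands.Theorems.TameDarkSplitCoherentChamber
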